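import Summits.QuantumFields.YangMills.Theorems.IR.AfPincerUcFormat
import Summits.QuantumFields.YangMills.Theorems.IR.TelescopedCodingCompose
import Summits.QuantumFields.YangMills.Theorems.IR.HaarCodingClusteringSeq
import Summits.QuantumFields.YangMills.Theorems.IR.LargeFieldRarityOddTori
import Literature.RepresentationTheory.CompactGroups.UnitaryTrick

/-!
# Line `smallfield-polymer-coder` (MECHANISM EDITION of the coding line) — crux `BalabanLadder.IR`
# (stmt-QuantumFields-19354), ideator `ym-ir-idea-4` g2 (lens: certified interpolation cluster-region → small-field region); rev 3 by g3, revs 4–6.1 by g4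

REV 6.1 (ym-ir-idea-4 g4, 2026-08-28T06:10Z) — (R≥) IS A TREE THEOREM: LEAD ab-p1 landed file 5 `Theorems/IR/LargeFieldRarityOddTori.lean`
(05:56Z; `LargeFieldRarityChessboard.largeFieldRarityOddTori_holds`), so `stub_largeFieldRarityLargeTori` becomes the theorem `largeFieldRarityLargeTori_holds`
(by name, no `sorry`; import switched from `LargeFieldRarityDefs` to `LargeFieldRarityOddTori`).  Stub set = FOUR `sorry`s, all YM content: `stub_oneStepSparseSSM`
(M-a∕c), `stub_bottomCoder_of_sparseSSM` (M-b), `stub_levelCondCoders` (levels), `stub_telescopedWall` (T ∧ U_× ∧ X).  The (R) leg of the line is CLOSED.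

REV 6 (ym-ir-idea-4 g4, 2026-08-28T05:50Z) — C3 `ComposeCond` (the floored one-step conditional composition over a general divisor
`M' ∣ M`) is GUARDED by `1 ≤ M` (the regime of its only consumer, `M = 2^{j⋆}`) and PROVED, sorry-free, in §2b∕§S2.7 (`composeCond_pos`,
`composeCond_holds`; `b₂ = 6b₃+2b₄+1`, `K₂ = max K₃ 0 + 1536(12b₃+3)⁴ max K₄ 0`): the nesting, law and graded-locality steps of rev 5 are
generalised from the factor `2` to any factor `t` (`nestMul`, `blockField_mul : blockField (tM) = nestMul t M ∘ blockField M`, `condLaw_step`,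
`gradedLocal_step` now over `t * M`; S₂ is the instance `t = 2`; rev 5's `nest2`∕`blockField_two_mul` are subsumed and removed).
`stub_telescopedRest` (C3 ∧ T ∧ U_× ∧ X) is REPLACED by `stub_telescopedWall : T ∧ U_× ∧ X`; `irCal_of_telescoped`'s `hC3` carries the guard
and `IR_of_mechanism` consumes `composeCond_holds`.  Stub set of rev 6 = FIVE `sorry`s, EVERY ONE YM CONTENT (no plumbing left):
`stub_oneStepSparseSSM` (M-a∕c), `stub_largeFieldRarityLargeTori` ((R≥), proved in `Lines/largefield_rarity_chessboard.lean`; tree landing files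
1–4 in, file 5 pending: then `exact largeFieldRarityOddTori_holds` — DONE in rev 6.1), `stub_bottomCoder_of_sparseSSM` (M-b), `stub_levelCondCoders` (levels),
`stub_telescopedWall` (T ∧ U_× ∧ X).  Re-registration is a LEAD action.

REV 5 (ym-ir-idea-4 g4, 2026-08-28T05:25Z) — S₂ `IterateCondCoders` (the floored iteration of conditional coders with LEVEL-INDEPENDENT
constants) is PROVED, sorry-free, in §2b (`iterateCondCoders_holds`; `b₃ = 12b+1`, `K₃ = 384·e·(144(16b+3)⁴+1)·max K 0`): exact two-fold
nesting of `blockField` on odd tori (`blockField_two_mul`, `nest2`), the exact law step on disjoint noise halves (`condLaw_step`), a graded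
locality invariant (radius `2^m(2bs+8b+1)`, tail `A(s+2)^4e^{-s}`; lower composite read at `s+4`, top level at `s`; union bound over
`≤ 64(2R'+3)^4` corner links, `card_corners_le`) and induction on the level (`inv_base`, `inv_step`, `inv_all`).  `IR_of_mechanism` now consumes
`iterateCondCoders_holds`; the stub `stub_iterateCondCoders` is GONE.  Registered-stub set of rev 5 = FIVE `sorry`s, all YM content or the
telescoped line's bundle: `stub_oneStepSparseSSM` (M-a∕c), `stub_largeFieldRarityLargeTori` ((R≥) — PROVED in
`Lines/largefield_rarity_chessboard.lean`; tree files 1–4 of the landing by LEAD ab-p1 are in (`LargeFieldRarity{Defs,FiniteSize,Increment,Engine}`),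
file 5 `LargeFieldRarityOddTori` pending: then `exact largeFieldRarityOddTori_holds`), `stub_bottomCoder_of_sparseSSM` (M-b),
`stub_levelCondCoders`, `stub_telescopedRest` (C3 floored ∧ T ∧ U_× ∧ X).  Everything else rev 4 verbatim.  Re-registration is a LEAD action.

REV 4 (ym-ir-idea-4 g4, 2026-08-28T05Z) — THE SMALL-TORI RESIDUAL (R<) IS OFF THE PATH; one change of plumbing, no new mathematics
claimed.  `GapInUnits` quantifies the tori `S ≥ S₁(β)` with `S₁` FREE, and every tree coding format carries its own torus floor
(`HaarCodedSeq … b` is asked on tori `≥ b`, `CondCodedSeq … M b₂` on tori `≥ M b₂`); so a `β`-dependent floor on the CONDITIONAL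
coders is threaded for free: §1b defines `CondCodedSeqFrom fl` (the tree format verbatim, asked on tori `≥ fl`), the bottom coder
(S₁'s first conjunct, `BottomCondCoder`), U_UV (`DeepSmallFieldCondCoder`), S₂ (`IterateCondCoders`) and C3 (`ComposeCond`) carry the
floor (pointwise in the torus; `fl = 0` is rev 3, `condCodedSeqFrom_zero_iff`), and C2 becomes `composeCoders_from` — PROVED here from
the tree's per-torus lemmas (`law_compose_of_coders`, `composite_locality`, p597846): coarse coder at `M` + floored conditional coder
below `M` ⇒ `HaarCodedSeq ρ K β (max (c·M) fl)`, the floor joining the RADIUS.  `irCal_of_telescoped` certifies the Wilson measure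
Haar-coded at radius `max (c·2^{j⋆(β)}) (volFloor β)`, which is all that `fmtSet`-non-emptiness asks (the pincer `fmtOnset_pinned`
bounds the onset itself; E = `codedClusteringSeq` and `gapInUnits_of_fmtOnset` are untouched).  CONSEQUENCE: the large-field
rarity is consumed by (M-b) ONLY on tori `2S+1 ≥ volFloor β = (⌈β⌉₊+2)²` — exactly (R≥) `LargeFieldRarityLargeTori`, PROVED
sorry-free in `Lines/largefield_rarity_chessboard.lean` (pending landing under `Theorems/IR/`, manifest
`Lines/largefield_rarity_chessboard_LANDING.md`); rev 3's (R<) `LargeFieldRaritySmallTori`, `largeFieldRarity_of_split` and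
`stub_largeFieldRaritySmallTori` are DELETED (not load-bearing — the femto-torus ∕ toron regime `2S+1 < (⌈β⌉₊+2)²` they asked about is
a genuine but separate question, census addendum `CENSUS-ym-ir-idea-4-g4.md` §3), and idea-5 g7's finer log floor
(`Lines/pressure_monotone_tm.lean` v3, `freeEnergyIncrementFrom_logFloor_holds`) is welcome but not needed here.  Registered-stub
set of rev 4 (SIX `sorry`s, was seven): `stub_iterateCondCoders` (S₂, floored signature), `stub_oneStepSparseSSM` (M-a∕c),
`stub_largeFieldRarityLargeTori` ((R≥): PROVED elsewhere, `exact` by name once landed), `stub_bottomCoder_of_sparseSSM` (M-b, now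
`OneStepSparseSSM → LargeFieldRarityLargeTori → BottomCondCoder`), `stub_levelCondCoders`, `stub_telescopedRest` (C3 floored ∧ T ∧ U_× ∧ X).
The (R) leg of the line is thereby COMPLETE modulo landing; the open YM content is unchanged: (M-a∕c) = `OneStepSparseSSM`, (M-b),
the level coders, and T ∧ U_× ∧ X of the telescoped line.  Re-registration (`ledger skeleton check`) is a LEAD action (RULING g9-№1 (2));
until then the registry shows rev 3.1's seven stubs.

REV 3 (ym-ir-idea-4 g3, 2026-08-28T03Z) — four changes, everything else rev 2 verbatim.  (1) REPAIR `C′` of `recon2` after the landed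
negative lemma `SmallFieldPolymerCoderNeg.not_oneStepSparseSSM` (`Theorems/IR/Negative/OneStepSparseSSMFalse.lean`, p595772,
class misstated∕type-level): only the CORNER line's first link (all coordinates even) is recomputed from the block field, so a
covered exterior `τ` with `blockField 2 L τ = V` is held at `τ` itself and the junk-measure witness (`U₀ = ∅`, law `0` vs a
probability law) is gone; (2) `OneStepSparseSSM` quantifies the small-field constant `A > 0` UNIVERSALLY (constants `K, b, β₃`
depend on `A`; (M-b) instantiates `A ≥ A₀` of (R)); (3) (R) RE-TYPED AND TWO-THIRDS DISCHARGED: `LargeFieldRarity` now reads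
`∃ (c A₀ β₃) ∀ A ≥ A₀ ∀ β ≥ β₃ ∀ odd tori 2S+1 ≥ 3` (one rate; no lower tail; no one-point torus) and is DERIVED
(`largeFieldRarity_of_split`, proved) from (R≥) `LargeFieldRarityLargeTori` — tori above the volume floor `(⌈β⌉₊+2)²`, PROVED
SORRY-FREE in `Cruxes/IR/Lines/largefield_rarity_chessboard.lean` (this seat; kernel-closed `largeFieldRarityOddTori_holds`; the
same chessboard-×-Chatterjee lever was published FIRST by ym-ir-idea-5 g6, `Lines/largefield_rarity_uniform.lean`) — and the
residual (R<) `LargeFieldRaritySmallTori` (small odd tori, research M); (4) §1's objects are the TREE constants of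
`Theorems/IR/TelescopedCodingDefs.lean` and the engine E (`HaarCodingEngine.codedClusteringSeq`, p597902) and the composition C2
(`TelescopedCoding.composeCoders_holds`, p597846) are consumed BY NAME: `IR_of_mechanism : C3 → T → U_× → X → BalabanLadder.IR`.
Registered `sorry`s: `stub_iterateCondCoders`, `stub_oneStepSparseSSM` (C′), `stub_largeFieldRarityLargeTori` (PROVED elsewhere,
pending landing), `stub_largeFieldRaritySmallTori`, `stub_bottomCoder_of_sparseSSM`, `stub_levelCondCoders`, and `stub_telescopedRest` = the conjunction of the
telescoped line's four remaining registered stubs C3 ∧ T ∧ U_× ∧ X (tracked in `Lines/telescoped_coding.lean`; bundled so that this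
skeleton's obligations are exactly its declared stubs); the strong-coupling rung is the sorry-free statement `RungStrongCouplingOneStep`.

PURPOSE (director-ym R366 (iv): «ideators' next deliverable = MECHANISM cards»).  ym-ir-crit-1 graded stub U_UV of
`Lines/telescoped_coding.lean` v2 (`stub_deepSmallFieldCondCoder`: the fine field GIVEN its `2^{j'}`-block holonomies is
conditionally coded at radius `O(2^{j'})` for every dyadic scale `λ` octaves below the minimal disordered scale) as
«supplier CLASS located, not a mechanism».  This file TYPES the mechanism one level down and keeps the kernel-checked
path to the route decl:

* S₁ `OneStepCondCoder` (research L–XL, ONE RENORMALISATION STEP, constants UNIFORM IN THE LEVEL; since rev 2 a THEOREM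
  `oneStepCondCoder_of_stubs` from the typed sub-stubs of §3b, see below): for all large `β`
  the fine field given its `2`-blocks, and the `2^i`-block field given the `2^{i+1}`-block field for every level `i` at
  least `λ` octaves below `jStar`, are conditionally coded at block radius `b` with one tail constant `K`.  This is the
  law-level form of ONE small-field renormalisation transformation of Bałaban (the fluctuation integral (2.1) of
  [corpus: paper:balaban1987-cmp109-rg-i-small-field p.17] IS «integrate the finer field given the next block averages»;
  its localized effective action with bounds `e^{-κ d_k(X)}`: CMP 109 Thm 3 p.16 + [corpus: paper:balaban1988-cmp116-rg-ii-cluster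
  p.1] «the two expansions … can be applied … for integrals conditioned to subdomains of the lattice»).  MECHANISM inside S₁
  (card `MECHANISM-ym-ir-idea-4.md` §2): (M-a) exponential STRONG SPATIAL MIXING in sub-region form for the one-step
  constrained measure in the small-field region — in the background-field chart the constrained fluctuation measure is an
  `O(g)`-perturbation of a FIXED massive Gaussian (constraint mass `≍ 1/L`), whose boundary influence is a harmonic
  extension decaying at the block scale (tree, Gaussian class: `Balaban1983to89/B4ContourShift.latticeKernel_decay`,
  `B4Eq19LatticeHarmonicDecay.harmonic_decay`, `B3Eq122TorusPropagators`; Hessians `B11HessianL2`, `B12Eq439WilsonHessian`);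
  (M-b) exponential SSM ⇒ finitary coder with exponential tails [corpus: paper:arxiv-1803.10578 p.3 Thm 1.1(b)] (finite
  spins; compact `G` + conditional + torus-uniform = plumbing with the sequence alphabet); (M-c) the ONE unprinted
  increment: robustness of (M-a) to SPARSE large-field cubes of the fine field (conditional probability `e^{-p₀(g)}` per
  cube, [corpus: paper:balaban1989-cmp122-large-field-i p.1 (0.1)] — a FIXED small factor in `d = 4`, «it controls a large
  number of steps, but this number is a small fraction») and of the conditioning block field (rarity under the block-field
  law), dense defects being the format's exceptional events (Peierls); Bałaban's `R`-operation preserves `∫ρ`, not `ρ`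
  (CMP 122 (0.4)), so it bounds free energies and says nothing about the conditional LAW near large fields.
* S₂ — rev 5: PROVED (`iterateCondCoders_holds`, §2b); was `stub_iterateCondCoders` (plumbing M–L, group- and `β`-blind; rev 3: stated for second-countable `G`, see C3): `n` one-step conditional coders with the SAME
  constants compose to a conditional coder of the fine field given its `2^n`-blocks with constants INDEPENDENT OF `n`
  (radii `Σ_i k_i b 2^i` are geometric; tails need level-dependent depths `k_i = k + c(n-i)`, `c > 4 log 2`, against the
  `(C k b 2^{n-i})⁴` level-`i` blocks in the window; re-index `k ↦ 2k`).
* §3b (rev 2; rev 3 repairs∕re-types as above) TYPES (M-a)∕(M-c), (R), (M-b) THEMSELVES over tree declarations: `OneStepSparseSSM` — sparse-defect strong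
  spatial mixing, sub-region form, of the explicit one-step window laws `oneStepLaw` (Wilson weight on the links of a window,
  block field held through `recon2` = free-link parametrisation of the fibre `{blockField 2 U = V}`, exterior held, interior
  restricted to `s_p ≤ A/β` on `checkedPlaqs`; (M-a) is the case `C = ∅`, (M-c) the case of `b`-separated lumps `C`);
  `LargeFieldRarity` — `P(∀ p ∈ Q, s_p > A/(2β)) ≤ e^{-cA|Q|}` uniformly in `β ≥ β₃` and the volume (shared supplier with
  NT's conditional-floor cards); `stub_bottomCoder_of_sparseSSM : OneStepSparseSSM → LargeFieldRarity → BottomCondCoder`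
  (M-b, Spinka's construction ported); `stub_levelCondCoders` (levels `i ≥ 1`, law-level, research); `condCodedSeq_mono`,
  `condBlockCodedSeq_mono` PROVED; `oneStepCondCoder_of : BottomCondCoder → LevelCondCoders → OneStepCondCoder` REAL.
* `deepSmallFieldCondCoder_of : S₁ → S₂ → U_UV` (REAL proof; `U_UV` string-equal to v2's `stub_deepSmallFieldCondCoder`).
* `irCal_of_telescoped` (v2, hypotheses form; rev 4: torus floor threaded) and `IR_of_mechanism : C3 → T → U_× → X → BalabanLadder.IR`
  (rev 3: E fed from the tree; rev 4: C2 = `composeCoders_from`, proved here) with U_UV DISCHARGED by `oneStepCondCoder_of_stubs` and S₂ — the route decl BY NAME; `sorry` only inside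
  `stub_*` / `rung_*` (rev 3 list above).
* `RungStrongCouplingOneStep` (typed rung exercising the CONDITIONAL format where it is decided: fine field given 2-blocks
  at `0 ≤ β ≤ β₀`, one-link Dobrushin with the determined link substituted — row sum `O(12 n β)`, `M`-free at `M = 2`).

Of the other v2 stubs, E and C2 are tree theorems (rev 3) and C3, T, U_×, X stay hypotheses of `IR_of_mechanism` (not re-registered);
T (cluster region at the minimal disordered scale) and U_× (the last `λ` octaves, conditional) remain WITHOUT mechanism —
card §1 locates them as the gap at resolution `2^λ` — and X keeps the AF-calibration status of every pincer line.

HONESTY.  Nothing here proves the Clay Yang–Mills mass gap, a lattice gap, or `BalabanLadder.IR`; the route's `closes` is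
conditional on `BalabanLadder.UV ∧ NT ∧ IR`; R4 of the ladder closes only the conditional finite-𝕋⁴ rung `BalabanLadder.UV`.
This file proves no research stub; (R≥) is proved in the supplier workfile named above (a theorem about the lattice
measure's large-field tail, implying nothing about `IR` by itself); S₁'s other sub-stubs are research (Bałaban-class, one level
below R4's machinery, plus the unprinted (M-c) = `OneStepSparseSSM` with `C ≠ ∅`).
-/

set_option autoImplicit false

noncomputable section

open Filter Topology MeasureTheory
open scoped SchwartzMap
open Literature.MathematicalPhysics.QuantumFieldTheory Literature.MathematicalPhysics.QuantumLattice
open Summit.QuantumFields.YangMills.Cruxes.OSLegsFromFemtoAndGap.DlrCollarTransfer (GapInUnits LowerBounds Q2)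
open Summit.QuantumFields.YangMills.Cruxes.IR.AfPincerUc (fmtSet fmtOnset FmtClustering fmtOnset_pinned
  gapInUnits_of_fmtOnset)
open Summit.QuantumFields.YangMills.Cruxes.IR.TelescopedCoding (supDist inputBall Noise seqNoise edgeRep blockField
  HaarCodedSeq CoarseCodedSeq CondCodedSeq CondBlockCodedSeq jStar composeCoders_holds reblock measurable_reblock
  reblock_blockField evenPart oddPart measurable_evenPart measurable_oddPart law_compose_of_coders composite_locality inputBall_mono)
open Summit.QuantumFields.YangMills.Cruxes.IR.HaarCodingEngine (codedClusteringSeq)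
open Summit.QuantumFields.YangMills.Cruxes.IR.LargeFieldRarityChessboard (volFloor LargeFieldRarityOddTori largeFieldRarityOddTori_holds)


namespace Summit.QuantumFields.YangMills.Cruxes.IR.SmallFieldPolymerCoder

/-! ## §1 Objects and formats — TREE CONSTANTS since rev 3: `supDist`, `inputBall`, `Noise`, `seqNoise`, `edgeRep`, `blockField`,
`HaarCodedSeq`, `CoarseCodedSeq`, `CondCodedSeq`, `CondBlockCodedSeq`, `jStar` live VERBATIM in `Theorems/IR/TelescopedCodingDefs.lean`
(p596243) and are opened above (rev 2 vendored copies); E = `HaarCodingEngine.codedClusteringSeq` (p597902) and C2 =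
`TelescopedCoding.composeCoders_holds` (p597846) are now tree THEOREMS and are CONSUMED BY NAME in `IR_of_mechanism`. -/

/-! ## §1b (rev 4) The TORUS FLOOR.  `GapInUnits` quantifies tori `S ≥ S₁(β)` with `S₁` FREE, and every tree format carries its own
floor (`HaarCodedSeq … b`: tori `≥ b`; `CondCodedSeq … M b₂`: tori `≥ M b₂`), so a `β`-dependent volume floor on the conditional coders costs
NOTHING downstream (`volFloor β = (⌈β⌉₊+2)²` is the TREE constant `LargeFieldRarityChessboard.volFloor` of `Theorems/IR/LargeFieldRarityDefs.lean`,
landed by LEAD ab-p1 2026-08-28T04:40Z): it is threaded through S₂, C3 and C2 (`composeCoders_from`, proved) into the RADIUS at which the Wilson measure is certified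
Haar-coded (`max (c·2^{j⋆}) (volFloor β)`), which only has to make `fmtSet` non-empty — the pincer bounds the onset `fmtOnset` itself.  Hence the
rarity (R) is consumed ONLY on tori `2S+1 ≥ volFloor β = (⌈β⌉₊+2)²`, where it is PROVED ((R≥)); rev 3's small-tori residual (R<) is off the path. -/

section FormatFrom

variable {G : Type} [Group G] [TopologicalSpace G] [IsTopologicalGroup G] [CompactSpace G]
  [MeasurableSpace G] [BorelSpace G]

/-- **CONDITIONAL CODER WITH A TORUS FLOOR `fl`** (rev 4): the tree format `TelescopedCoding.CondCodedSeq ρ K β M b₂` VERBATIM, asked only on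
the odd tori `2S+1 ≥ fl` (besides the format's own `2S+1 ≥ M b₂`).  `fl = 0` is the tree format (`condCodedSeqFrom_zero_iff`). -/
def CondCodedSeqFrom (fl : ℕ) {N : ℕ} (ρ : G →* Matrix (Fin N) (Fin N) ℂ) (K : ℝ) (β : ℝ) (M b₂ : ℕ) : Prop :=
  ∀ S : ℕ, M * b₂ ≤ 2 * S + 1 → fl ≤ 2 * S + 1 →
    ∃ Ψ : GaugeConfig 4 (2 * S + 1) G × Noise G (2 * S + 1) → GaugeConfig 4 (2 * S + 1) G, Measurable Ψ ∧
      (((wilsonMeasure (d := 4) (L := 2 * S + 1) ρ β).map (blockField M (2 * S + 1))).prod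
          (seqNoise G (2 * S + 1))).map (fun p => (p.1, Ψ p)) =
        (wilsonMeasure (d := 4) (L := 2 * S + 1) ρ β).map (fun U => (blockField M (2 * S + 1) U, U)) ∧
      ∀ (e : Literature.MathematicalPhysics.QuantumLattice.ZdEdge 4) (k : ℕ), 1 ≤ k →
        ∃ Ψ' : GaugeConfig 4 (2 * S + 1) G × Noise G (2 * S + 1) → G, Measurable Ψ' ∧
          (∀ p q : GaugeConfig 4 (2 * S + 1) G × Noise G (2 * S + 1),
            (∀ x ∈ inputBall (2 * S + 1) e (k * (M * b₂)), p.1 x = q.1 x) →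
            (∀ y : ℕ × Literature.MathematicalPhysics.QuantumFieldTheory.Edge 4 (2 * S + 1),
              y.2 ∈ inputBall (2 * S + 1) e (k * (M * b₂)) → p.2 y = q.2 y) → Ψ' p = Ψ' q) ∧
          (((wilsonMeasure (d := 4) (L := 2 * S + 1) ρ β).map (blockField M (2 * S + 1))).prod
              (seqNoise G (2 * S + 1))) {p | Ψ p (torusEdge (2 * S + 1) e) ≠ Ψ' p} ≤
            ENNReal.ofReal (K * Real.exp (-(k : ℝ)))

/-- The tree format implies the floored one at every floor (proved). -/
theorem condCodedSeqFrom_of (fl : ℕ) {N : ℕ} (ρ : G →* Matrix (Fin N) (Fin N) ℂ) (K : ℝ) (β : ℝ) (M b₂ : ℕ)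
    (h : CondCodedSeq ρ K β M b₂) : CondCodedSeqFrom fl ρ K β M b₂ :=
  fun S hS _ => h S hS

/-- Floor `0` is the tree format (proved). -/
theorem condCodedSeqFrom_zero_iff {N : ℕ} (ρ : G →* Matrix (Fin N) (Fin N) ℂ) (K : ℝ) (β : ℝ) (M b₂ : ℕ) :
    CondCodedSeqFrom 0 ρ K β M b₂ ↔ CondCodedSeq ρ K β M b₂ :=
  ⟨fun h S hS => h S hS (Nat.zero_le _), condCodedSeqFrom_of 0 ρ K β M b₂⟩

/-- Monotonicity of the floored format in the floor (proved). -/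
theorem condCodedSeqFrom_floor_mono {fl fl' : ℕ} (hfl : fl ≤ fl') {N : ℕ} (ρ : G →* Matrix (Fin N) (Fin N) ℂ) (K : ℝ) (β : ℝ)
    (M b₂ : ℕ) (h : CondCodedSeqFrom fl ρ K β M b₂) : CondCodedSeqFrom fl' ρ K β M b₂ :=
  fun S hS hS' => h S hS (le_trans hfl hS')

end FormatFrom

/-! ## §2 The mechanism one level below U_UV: two REGISTERED stubs (+ one typed rung) -/

section Mechanism

/-- **S₁ — ONE RENORMALISATION STEP as a conditional coder, constants UNIFORM IN THE LEVEL** (research L–XL; supplier: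
Bałaban CMP 109 (1987) Thm 3 + CMP 116 (1988) — the small-field fluctuation integral of one RG step IS the law of the finer
field given the next block averages, with a localized effective action; mechanism (M-a) sub-region exponential strong
spatial mixing of the one-step constrained measure at the block scale ⇒ (M-b) Spinka-type coder; unprinted (M-c):
robustness to sparse large-field cubes of the fine AND of the conditioning field).  For every compact simple `G`, lattice
representation `r` and coarse constants `(K₁, b₁)` there are `λ, K, b, β₃` such that for all `β ≥ β₃`: (bottom) the fine
field given its `2`-block holonomies is conditionally coded at block radius `b`, tail constant `K`; (levels) for every
`i ≥ 1` with `i + 1 + λ ≤ jStar(β)` — i.e. every dyadic level at least `λ` octaves below the MINIMAL disordered scale, where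
the running coupling is below a fixed `g⋆(λ)` — the `2^i`-block field given the `2^{i+1}`-block field is conditionally
coded at block radius `b` (fine radius `k·b·2^{i+1}`) with the SAME tail constant `K`.  Rev 4: the bottom conjunct is asked
only on tori `2S+1 ≥ volFloor β` (§1b). -/
def OneStepCondCoder : Prop :=
  ∀ (G : Type) [Group G] [TopologicalSpace G] [IsTopologicalGroup G] [CompactSpace G],
    IsCompactSimpleLieGroup G →
    letI : MeasurableSpace G := borel G
    haveI : BorelSpace G := ⟨rfl⟩
    ∀ (r : LatticeRep G) (K₁ : ℝ) (b₁ : ℕ), ∃ (lam : ℕ) (K : ℝ) (b : ℕ) (β₃ : ℝ), ∀ β : ℝ, β₃ ≤ β →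
      CondCodedSeqFrom (volFloor β) r.ρ K β 2 b ∧
      ∀ i : ℕ, 1 ≤ i → i + 1 + lam ≤ jStar r.ρ K₁ b₁ β →
        CondBlockCodedSeq r.ρ K β (2 ^ i) (2 ^ (i + 1)) b

/-- **S₂ — ITERATION with level-independent constants** (plumbing M–L, provable now, group- and `β`-blind): a conditional
coder of the fine field given its `2`-blocks and one-step conditional block coders `2^i ← 2^{i+1}` for `1 ≤ i < n`, all
with constants `(K, b)`, compose to a conditional coder of the fine field given its `2^n`-blocks with constants
`(K₃, b₃)` depending on `(K, b)` ONLY.  Plan: exactness by the nesting identities `blockField 2^{i+1} = F ∘ blockField 2^i`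
(seam-exact truncated blocks on odd tori) and disjoint noise sub-sequences per level; locality: level `i` is read at depth
`k_i = k + c (n - i)` with `c > 4 log 2`, so the input radius `Σ_i k_i b 2^{i+1} ≤ 4 (k + 2c) b 2^n` is geometric and the
union bound over the `≤ (C k b 2^{n-i})⁴` level-`i` blocks in the window gives tails `K (C k b)⁴ e^{-k} Σ_m 2^{4m} e^{-c m}`;
re-index `k ↦ 2k`.  Degenerate cases: `n = 0` is the identity coder (`blockField 1 = id`), `n = 1` is monotonicity of the
format in `(K, b)`.  Rev 4: stated with a TORUS FLOOR `fl` carried from hypothesis to conclusion (the composition is pointwise in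
the torus; `fl = 0` is rev 3's statement, `condCodedSeqFrom_zero_iff`). -/
def IterateCondCoders : Prop :=
  ∀ (K : ℝ) (b : ℕ), ∃ (K₃ : ℝ) (b₃ : ℕ),
    ∀ (G : Type) [Group G] [TopologicalSpace G] [IsTopologicalGroup G] [CompactSpace G]
      [MeasurableSpace G] [BorelSpace G] [SecondCountableTopology G] {N : ℕ} (ρ : G →* Matrix (Fin N) (Fin N) ℂ) (β : ℝ) (n fl : ℕ),
      CondCodedSeqFrom fl ρ K β 2 b →
      (∀ i : ℕ, 1 ≤ i → i < n → CondBlockCodedSeq ρ K β (2 ^ i) (2 ^ (i + 1)) b) →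
        CondCodedSeqFrom fl ρ K₃ β (2 ^ n) b₃

/-- **U_UV — the v2 stub `TelescopedCoding.stub_deepSmallFieldCondCoder`** (derived below, not a stub here; rev 4: VERBATIM but
for the torus floor `volFloor β`): `λ` octaves below the minimal disordered scale the fine field given its `2^{j'}`-blocks is
conditionally coded at radius `O(2^{j'})`, on every odd torus `2S+1 ≥ volFloor β`. -/
def DeepSmallFieldCondCoder : Prop :=
  ∀ (G : Type) [Group G] [TopologicalSpace G] [IsTopologicalGroup G] [CompactSpace G],
    IsCompactSimpleLieGroup G →
    letI : MeasurableSpace G := borel G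
    haveI : BorelSpace G := ⟨rfl⟩
    ∀ (r : LatticeRep G) (K₁ : ℝ) (b₁ : ℕ), ∃ (lam : ℕ) (K₃ : ℝ) (b₃ : ℕ) (β₃ : ℝ), ∀ β : ℝ, β₃ ≤ β →
      ∀ j' : ℕ, (j' + lam ≤ jStar r.ρ K₁ b₁ β ∨ j' = 0) → CondCodedSeqFrom (volFloor β) r.ρ K₃ β (2 ^ j') b₃

/- rev 5: S₂ `IterateCondCoders` is PROVED in §2b below (`iterateCondCoders_holds`); the rev ≤ 4 stub `stub_iterateCondCoders` is gone. -/

/-- rung R1 (strong coupling, size M–L; exercises the CONDITIONAL format where it is DECIDED, outside the crux's `β → ∞`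
regime; not consumed below; rev 3: a TYPED STATEMENT `def … : Prop` — its proof is a prover target, not a stub of the line, so it
carries no `sorry`): **for `0 ≤ β ≤ β₀(G, r)` the fine field given its `2`-block holonomies is conditionally coded at
a fixed block radius `b₀`.**  Route: parametrise the fibre `{U : blockField 2 U = V}` by the free links (one link per block
line is the `V`-translate of the inverse product of the others — Haar-invariant, so the conditional law is an honest Gibbs
measure on the free links with range-`2` interaction); each free link meets `≤ 6` own plaquettes and `≤ 6` plaquettes of the
ONE determined link of its line, so the one-link Dobrushin∕KR row sum is `O(12 n β) < 1` for `β ≤ β₀` (tree window: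
`Literature/…/LatticeGaugeDobrushin.lean` `shen_zhu_zhu_of_dobrushinCondition`), uniformly in `V` and the torus; coupling from
the past driven by the sequence noise gives the coder with exponential tails (Häggström–Steif, Combin. Probab. Comput. 9
(2000); van den Berg–Steif, Ann. Probab. 27 (1999)). -/
def RungStrongCouplingOneStep : Prop :=
    ∀ (G : Type) [Group G] [TopologicalSpace G] [IsTopologicalGroup G] [CompactSpace G],
      IsCompactSimpleLieGroup G →
      letI : MeasurableSpace G := borel G
      haveI : BorelSpace G := ⟨rfl⟩
      ∀ (r : LatticeRep G), ∃ (K β₀ : ℝ) (b₀ : ℕ), 0 < β₀ ∧ 1 ≤ b₀ ∧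
        ∀ β : ℝ, 0 ≤ β → β ≤ β₀ → CondCodedSeq r.ρ K β 2 b₀

/-! ## §3 The kernel-checked split `S₁ → S₂ → U_UV` -/

/-- **`U_UV` from the two stubs (real proof).**  Given `(G, r, K₁, b₁)`: S₁ supplies `λ, K, b, β₃`; S₂ turns `(K, b)` into
`(K₃, b₃)`; for `β ≥ β₃` and `j'` with `j' + λ ≤ jStar β` (or `j' = 0`) apply S₂ with `n := j'` — its one-step hypotheses at
levels `1 ≤ i < j'` hold because `i + 1 + λ ≤ j' + λ ≤ jStar β` (and are vacuous when `j' = 0`). -/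
theorem deepSmallFieldCondCoder_of (hS1 : OneStepCondCoder) (hS2 : IterateCondCoders) :
    DeepSmallFieldCondCoder := by
  intro G _ _ _ _ hG
  letI : MeasurableSpace G := borel G
  haveI : BorelSpace G := ⟨rfl⟩
  intro r K₁ b₁
  haveI : SecondCountableTopology G :=
    (r.continuous.isClosedEmbedding r.injective).isEmbedding.secondCountableTopology
  obtain ⟨lam, K, b, β₃, h1⟩ := hS1 G hG r K₁ b₁
  obtain ⟨K₃, b₃, hit⟩ := hS2 K b
  refine ⟨lam, K₃, b₃, β₃, fun β hβ j' hj' => ?_⟩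
  obtain ⟨hbot, hlev⟩ := h1 β hβ
  refine hit G r.ρ β j' (volFloor β) hbot ?_
  intro i hi1 hin
  refine hlev i hi1 ?_
  rcases hj' with h | h
  · omega
  · omega

end Mechanism

/-! ## §2b (rev 5) S₂ PROVED — `iterateCondCoders_holds : IterateCondCoders`; (rev 6) C3 PROVED — `composeCond_pos` ∕ `composeCond_holds : ComposeCond` (§S2.7) (ym-ir-idea-4 g4, 2026-08-28).
Exact `t`-fold nesting `blockField (tM) = nestMul t M ∘ blockField M` on odd tori (seam-exact truncated blocks; rev 5 had the factor `2` only), the law step by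
disjoint noise halves (`splitNoise`), a GRADED locality invariant (radius `2^m (2bs+8b+1)`, tail `A (s+2)^4 e^{-s}`, lower composite read
at `s+4`, top level at `s`, union bound over `≤ 64(2R'+3)^4` corner links counted uniformly in `M`), induction on the level, and the
re-indexing `s = 2k`: `b₃ = 12b+1`, `K₃ = 384·e·(144(16b+3)⁴+1)·max K 0`.  Pure measure theory / arithmetic over the tree's
`TelescopedCoding*` API; no `sorry`. -/

section S2Proof

open Summit.QuantumFields.YangMills.Cruxes.IR.TelescopedCoding

/-! ## §S2.1 Block bases, natural links, exact `t`-fold nesting of `blockField` (`nestMul`, `blockField_mul`) -/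

section Nesting

variable {G : Type}

/-- Base point (natural coordinates `M ⌊x_l / M⌋`) of the `M`-block containing the site of `q`. -/
def blockBase (M N : ℕ) (q : Edge 4 N) : Fin 4 → ℕ := fun l => M * ((q.1 l).val / M)

/-- The torus link at natural coordinates `c`, direction `i`. -/
def natLink (N : ℕ) (c : Fin 4 → ℕ) (i : Fin 4) : Edge 4 N := (fun l => ((c l : ℕ) : ZMod N), i)

theorem natLink_snd (N : ℕ) (c : Fin 4 → ℕ) (i : Fin 4) : (natLink N c i).2 = i := rfl

theorem natLink_val {N : ℕ} [NeZero N] {c : Fin 4 → ℕ} (hc : ∀ l, c l < N) (i l : Fin 4) :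
    ((natLink N c i).1 l).val = c l := by
  simp only [natLink, ZMod.val_natCast, Nat.mod_eq_of_lt (hc l)]

theorem blockField_eq_prod [Group G] (M N : ℕ) (U : GaugeConfig 4 N G) (q : Edge 4 N) :
    blockField M N U q = (((List.range M).filter fun j => blockBase M N q q.2 + j < N).map fun j =>
      U (torusEdge N ((fun l => ((blockBase M N q l : ℕ) : ℤ)) + Pi.single q.2 (j : ℤ), q.2))).prod := rfl

/-- `blockField` in normal form: a product over a list of NATURAL offsets (the definition's list carries a coercion
through the `List` monad). -/
theorem blockField_apply' [Group G] (M N : ℕ) (U : GaugeConfig 4 N G) (q : Edge 4 N) :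
    blockField M N U q = (((List.range M).filter fun j => blockBase M N q q.2 + j < N).map fun j : ℕ =>
      U (torusEdge N ((fun l => ((blockBase M N q l : ℕ) : ℤ)) + Pi.single q.2 ((j : ℕ) : ℤ), q.2))).prod := by
  rw [blockField_eq_prod]
  simp only [bind_pure_comp, List.map_eq_map, List.map_map]
  rfl

/-- The block base of a link sitting at an `M`-corner with in-range coordinates is that corner. -/
theorem blockBase_natLink {M N : ℕ} [NeZero N] {c : Fin 4 → ℕ} (hc : ∀ l, c l < N) (hdiv : ∀ l, M ∣ c l)
    (i : Fin 4) : blockBase M N (natLink N c i) = c := by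
  funext l
  simp only [blockBase, natLink_val hc, Nat.mul_div_cancel' (hdiv l)]

theorem blockBase_lt {M N : ℕ} [NeZero N] (q : Edge 4 N) (l : Fin 4) : blockBase M N q l < N :=
  lt_of_le_of_lt (Nat.mul_div_le _ _) (ZMod.val_lt _)

theorem dvd_blockBase (M N : ℕ) (q : Edge 4 N) (l : Fin 4) : M ∣ blockBase M N q l := ⟨_, rfl⟩

/-- `blockField 1` is the identity. -/
theorem blockField_one [Group G] {N : ℕ} [NeZero N] (U : GaugeConfig 4 N G) : blockField 1 N U = U := by
  funext q
  rw [blockField_apply']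
  have hb : ∀ l, blockBase 1 N q l = (q.1 l).val := fun l => by simp [blockBase]
  have hfilt : ((List.range 1).filter fun j => blockBase 1 N q q.2 + j < N) = [(0 : ℕ)] := by
    rw [List.range_one, List.filter_singleton]
    have : decide (blockBase 1 N q q.2 + 0 < N) = true := by
      rw [decide_eq_true_eq, hb, add_zero]; exact ZMod.val_lt _
    rw [this]; rfl
  rw [hfilt]
  simp only [List.map_cons, List.map_nil, List.prod_cons, List.prod_nil, mul_one]
  congr 1
  refine Prod.ext ?_ rfl
  funext l
  simp only [torusEdge, Literature.Probability.LatticeModels.Torus.proj, Pi.add_apply, hb, Nat.cast_zero, Pi.single_zero,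
    Pi.zero_apply, add_zero, Int.cast_natCast, ZMod.natCast_zmod_val]

/-- **General nesting map**: the `tM`-block field as a function of the `M`-block field `W` — the product of the `M`-block values at
the `t` consecutive `M`-corners of the `tM`-block line, dropping those that start outside the fundamental domain. -/
def nestMul [Group G] (t M N : ℕ) (W : GaugeConfig 4 N G) : GaugeConfig 4 N G := fun q =>
  (((List.range t).filter fun m => blockBase (t * M) N q q.2 + m * M < N).map fun m : ℕ =>
      W (natLink N (blockBase (t * M) N q + Pi.single q.2 (m * M)) q.2)).prod

theorem measurable_nestMul [Group G] [MeasurableSpace G] [MeasurableMul₂ G] (t M N : ℕ) :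
    Measurable (nestMul (G := G) t M N) := by
  refine measurable_pi_lambda _ fun q => ?_
  have h : (fun W : GaugeConfig 4 N G => nestMul t M N W q) = fun W =>
      ((((List.range t).filter fun m => blockBase (t * M) N q q.2 + m * M < N).map
        fun (m : ℕ) (W : GaugeConfig 4 N G) => W (natLink N (blockBase (t * M) N q + Pi.single q.2 (m * M)) q.2)).map
        fun f => f W).prod := by
    funext W; simp only [nestMul, List.map_map]; rfl
  rw [h]
  refine List.measurable_fun_prod _ fun f hf => ?_
  obtain ⟨m, -, rfl⟩ := List.mem_map.1 hf
  exact measurable_pi_apply _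

/-- One straight line of `t·M` links from an `M`-corner `c` in direction `i` (truncated at the domain edge) is the product of
the `t` consecutive `M`-block values along it. -/
theorem blockLine_aux [Group G] {M N : ℕ} [NeZero N] (U : GaugeConfig 4 N G) (c : Fin 4 → ℕ)
    (hcN : ∀ l, c l < N) (hcM : ∀ l, M ∣ c l) (i : Fin 4) (t : ℕ) :
    (((List.range (t * M)).filter fun j => c i + j < N).map fun j : ℕ =>
        U (torusEdge N ((fun l => ((c l : ℕ) : ℤ)) + Pi.single i ((j : ℕ) : ℤ), i))).prod =
    (((List.range t).filter fun m => c i + m * M < N).map fun m : ℕ =>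
        blockField M N U (natLink N (c + Pi.single i (m * M)) i)).prod := by
  set f : ℕ → G := fun j => U (torusEdge N ((fun l => ((c l : ℕ) : ℤ)) + Pi.single i ((j : ℕ) : ℤ), i)) with hf
  induction t with
  | zero => simp
  | succ t ih =>
    have hr : List.range ((t + 1) * M) = List.range (t * M) ++ (List.range M).map (fun j => t * M + j) := by
      rw [Nat.succ_mul, List.range_add]
    rw [hr, List.filter_append, List.map_append, List.prod_append, ih, List.range_succ, List.filter_append,
      List.map_append, List.prod_append]
    congr 1
    set c' : Fin 4 → ℕ := c + Pi.single i (t * M) with hc'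
    rw [List.filter_map, List.map_map, List.filter_singleton]
    by_cases hlt : c i + t * M < N
    · rw [decide_eq_true hlt]
      simp only [cond_true, List.map_cons, List.map_nil, List.prod_cons, List.prod_nil, mul_one]
      rw [blockField_apply', natLink_snd]
      have hc'N : ∀ l, c' l < N := by
        intro l
        by_cases hl : l = i
        · rw [hl]; simpa [hc'] using hlt
        · simp only [hc', Pi.add_apply, Pi.single_eq_of_ne hl, add_zero]; exact hcN l
      have hc'M : ∀ l, M ∣ c' l := by
        intro l
        by_cases hl : l = i
        · rw [hl]; simpa [hc'] using (hcM i).add (Dvd.intro_left t rfl)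
        · simp only [hc', Pi.add_apply, Pi.single_eq_of_ne hl, add_zero]; exact hcM l
      rw [blockBase_natLink hc'N hc'M]
      have hpred : ((fun j => decide (c i + j < N)) ∘ fun j => t * M + j) = fun j => decide (c' i + j < N) := by
        funext j; simp only [Function.comp, hc', Pi.add_apply, Pi.single_eq_same, add_assoc]
      have hsum : (f ∘ fun j => t * M + j) = fun j : ℕ =>
          U (torusEdge N ((fun l => ((c' l : ℕ) : ℤ)) + Pi.single i (j : ℤ), i)) := by
        funext j
        simp only [Function.comp, hf]
        congr 2
        refine Prod.ext ?_ rfl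
        funext l
        by_cases hl : l = i
        · rw [hl]; simp only [hc', Pi.add_apply, Pi.single_eq_same]; push_cast; ring
        · simp only [hc', Pi.add_apply, Pi.single_eq_of_ne hl, add_zero]
      rw [hpred, hsum]
    · have hd : decide (c i + t * M < N) = false := decide_eq_false hlt
      rw [hd]
      simp only [cond_false, List.map_nil, List.prod_nil]
      have hnil : ((List.range M).filter ((fun j => decide (c i + j < N)) ∘ fun j => t * M + j)) = [] := by
        rw [List.filter_eq_nil_iff]
        intro j _
        simp only [Function.comp, decide_eq_true_eq, not_lt]
        omega
      rw [hnil, List.map_nil, List.prod_nil]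

/-- **`blockField` nests exactly under any integer coarsening of the block side** (odd or even torus, any `M > 0`, any `t`). -/
theorem blockField_mul [Group G] {t M N : ℕ} [NeZero N] (hM : 0 < M) (U : GaugeConfig 4 N G) :
    blockField (t * M) N U = nestMul t M N (blockField M N U) := by
  funext q
  simp only [nestMul]
  rw [blockField_apply' (t * M)]
  exact blockLine_aux U (blockBase (t * M) N q) (fun l => blockBase_lt q l)
    (fun l => (Dvd.intro_left t rfl : M ∣ t * M).trans (dvd_blockBase (t * M) N q l)) q.2 t

end Nesting


/-! ## §S2.2 Measurability of the block field; the law identity of a two-level conditional composition -/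

section LawStep

variable {G : Type} [Group G] [TopologicalSpace G] [IsTopologicalGroup G] [CompactSpace G]
  [MeasurableSpace G] [BorelSpace G] [SecondCountableTopology G]

/-- The block-holonomy field is measurable (finite products of evaluations; `G` second countable). -/
theorem measurable_blockField (M N : ℕ) : Measurable (blockField (G := G) M N) := by
  refine measurable_pi_lambda _ fun q => ?_
  have h : (fun U : GaugeConfig 4 N G => blockField M N U q) = fun U =>
      ((((List.range M).filter fun j => blockBase M N q q.2 + j < N).map fun (j : ℕ) (U : GaugeConfig 4 N G) =>
        U (torusEdge N ((fun l => ((blockBase M N q l : ℕ) : ℤ)) + Pi.single q.2 ((j : ℕ) : ℤ), q.2))).map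
        fun f => f U).prod := by
    funext U; rw [blockField_apply', List.map_map]; rfl
  rw [h]
  refine List.measurable_fun_prod _ fun f hf => ?_
  obtain ⟨j, -, rfl⟩ := List.mem_map.1 hf
  exact measurable_pi_apply _

variable {N : ℕ} (ρ : G →* Matrix (Fin N) (Fin N) ℂ) (β : ℝ)

/-- **Law step.** If `C` samples the fine field given its `M`-block field and `B` samples the `M`-block field given the
`2M`-block field (exact conditional samplers driven by independent sequence noises), then
`(V, ω) ↦ C (reblock M (B (V, ω_even)), ω_odd)` samples the fine field given its `2M`-block field.  Pure measure algebra
over the exact nesting `blockField (tM) = nestMul t M ∘ blockField M`. -/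
theorem condLaw_step {S M t : ℕ} (hM : 0 < M)
    {C B : GaugeConfig 4 (2 * S + 1) G × Noise G (2 * S + 1) → GaugeConfig 4 (2 * S + 1) G}
    (hC : Measurable C) (hB : Measurable B)
    (hClaw : (((wilsonMeasure (d := 4) (L := 2 * S + 1) ρ β).map (blockField M (2 * S + 1))).prod
        (seqNoise G (2 * S + 1))).map (fun p => (p.1, C p)) =
      (wilsonMeasure (d := 4) (L := 2 * S + 1) ρ β).map (fun U => (blockField M (2 * S + 1) U, U)))
    (hBlaw : (((wilsonMeasure (d := 4) (L := 2 * S + 1) ρ β).map (blockField (t * M) (2 * S + 1))).prod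
        (seqNoise G (2 * S + 1))).map (fun p => (p.1, B p)) =
      (wilsonMeasure (d := 4) (L := 2 * S + 1) ρ β).map
        (fun U => (blockField (t * M) (2 * S + 1) U, blockField M (2 * S + 1) U))) :
    (((wilsonMeasure (d := 4) (L := 2 * S + 1) ρ β).map (blockField (t * M) (2 * S + 1))).prod
        (seqNoise G (2 * S + 1))).map
        (fun p => (p.1, C (reblock M (2 * S + 1) (B (p.1, evenPart p.2)), oddPart p.2))) =
      (wilsonMeasure (d := 4) (L := 2 * S + 1) ρ β).map (fun U => (blockField (t * M) (2 * S + 1) U, U)) := by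
  haveI : IsProbabilityMeasure (seqNoise G (2 * S + 1)) := isProbabilityMeasure_seqNoise _
  haveI : SFinite (wilsonMeasure (d := 4) (L := 2 * S + 1) ρ β) := by
    unfold wilsonMeasure wilsonWeight; infer_instance
  -- names
  set μ : Measure (GaugeConfig 4 (2 * S + 1) G) := wilsonMeasure (d := 4) (L := 2 * S + 1) ρ β with hμ
  set ν : Measure (Noise G (2 * S + 1)) := seqNoise G (2 * S + 1) with hν
  have hbf : ∀ M', Measurable (blockField (G := G) M' (2 * S + 1)) := fun M' => measurable_blockField M' _
  have hrb : Measurable (reblock (G := G) M (2 * S + 1)) := measurable_reblock _ _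
  have hn2 : Measurable (nestMul (G := G) t M (2 * S + 1)) := measurable_nestMul _ _ _
  -- the three maps
  set g : GaugeConfig 4 (2 * S + 1) G × Noise G (2 * S + 1) → GaugeConfig 4 (2 * S + 1) G × GaugeConfig 4 (2 * S + 1) G :=
    fun p => (p.1, reblock M (2 * S + 1) (B p)) with hg
  have hgm : Measurable g := measurable_fst.prodMk (hrb.comp hB)
  set F : GaugeConfig 4 (2 * S + 1) G × Noise G (2 * S + 1) →
      (GaugeConfig 4 (2 * S + 1) G × GaugeConfig 4 (2 * S + 1) G) × Noise G (2 * S + 1) :=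
    fun p => ((p.1, reblock M (2 * S + 1) (B (p.1, evenPart p.2))), oddPart p.2) with hF
  set H : (GaugeConfig 4 (2 * S + 1) G × GaugeConfig 4 (2 * S + 1) G) × Noise G (2 * S + 1) →
      GaugeConfig 4 (2 * S + 1) G × GaugeConfig 4 (2 * S + 1) G := fun r => (r.1.1, C (r.1.2, r.2)) with hH
  have hHm : Measurable H := (measurable_fst.comp measurable_fst).prodMk
    (hC.comp ((measurable_snd.comp measurable_fst).prodMk measurable_snd))
  have hFeq : F = ((Prod.map g id) ∘ ⇑(MeasurableEquiv.prodAssoc.symm)) ∘ (Prod.map id splitNoise) := by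
    funext p; rfl
  have hFm : Measurable F := by
    rw [hFeq]
    exact (hgm.prodMap measurable_id).comp
      ((MeasurableEquiv.prodAssoc.symm).measurable.comp (measurable_id.prodMap measurable_splitNoise))
  have htarget : (fun p : GaugeConfig 4 (2 * S + 1) G × Noise G (2 * S + 1) =>
      (p.1, C (reblock M (2 * S + 1) (B (p.1, evenPart p.2)), oddPart p.2))) = H ∘ F := by
    funext p; rfl
  -- Claim 1: the law of `F`
  have hτ : (((μ.map (blockField (t * M) (2 * S + 1))).prod ν).map g) =
      μ.map (fun U => (blockField (t * M) (2 * S + 1) U, blockField M (2 * S + 1) U)) := by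
    have hg' : g = (Prod.map id (reblock M (2 * S + 1))) ∘ (fun p => (p.1, B p)) := by funext p; rfl
    rw [hg', ← Measure.map_map (measurable_id.prodMap hrb) (measurable_fst.prodMk hB), hBlaw,
      Measure.map_map (measurable_id.prodMap hrb) ((hbf _).prodMk (hbf _))]
    have hfun : (Prod.map id (reblock M (2 * S + 1))) ∘
        (fun U : GaugeConfig 4 (2 * S + 1) G => (blockField (t * M) (2 * S + 1) U, blockField M (2 * S + 1) U)) =
        fun U => (blockField (t * M) (2 * S + 1) U, blockField M (2 * S + 1) U) := by
      funext U; simp only [Function.comp, Prod.map, id, reblock_blockField hM]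
    rw [hfun]
  have h1 : ((μ.map (blockField (t * M) (2 * S + 1))).prod ν).map F =
      (μ.map (fun U => (blockField (t * M) (2 * S + 1) U, blockField M (2 * S + 1) U))).prod ν := by
    rw [hFeq, ← Measure.map_map ((hgm.prodMap measurable_id).comp (MeasurableEquiv.prodAssoc.symm).measurable)
      (measurable_id.prodMap measurable_splitNoise)]
    rw [← Measure.map_prod_map _ _ measurable_id measurable_splitNoise, Measure.map_id, seqNoise_map_splitNoise]
    rw [← Measure.map_map (hgm.prodMap measurable_id) (MeasurableEquiv.prodAssoc.symm).measurable]
    rw [((MeasureTheory.measurePreserving_prodAssoc (μ.map (blockField (t * M) (2 * S + 1))) ν ν).symm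
      MeasurableEquiv.prodAssoc).map_eq]
    rw [← Measure.map_prod_map _ _ hgm measurable_id, Measure.map_id, hτ]
  -- Claim 2: `τ ⊗ ν` from the `M`-level pair law via nesting
  have hnm : Measurable (fun W : GaugeConfig 4 (2 * S + 1) G => (nestMul t M (2 * S + 1) W, W)) :=
    hn2.prodMk measurable_id'
  have h2 : (μ.map (fun U => (blockField (t * M) (2 * S + 1) U, blockField M (2 * S + 1) U))).prod ν =
      ((μ.map (blockField M (2 * S + 1))).prod ν).map
        (Prod.map (fun W => (nestMul t M (2 * S + 1) W, W)) id) := by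
    rw [← Measure.map_prod_map _ _ hnm measurable_id, Measure.map_id, Measure.map_map hnm (hbf M)]
    have hfun : ((fun W : GaugeConfig 4 (2 * S + 1) G => (nestMul t M (2 * S + 1) W, W)) ∘ blockField M (2 * S + 1)) =
        fun U => (blockField (t * M) (2 * S + 1) U, blockField M (2 * S + 1) U) := by
      funext U; simp only [Function.comp, blockField_mul (t := t) hM]
    rw [hfun]
  -- assemble
  rw [htarget, ← Measure.map_map hHm hFm, h1, h2, Measure.map_map hHm (hnm.prodMap measurable_id)]
  have hHF : H ∘ Prod.map (fun W => (nestMul t M (2 * S + 1) W, W)) id =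
      (Prod.map (nestMul t M (2 * S + 1)) id) ∘ (fun p => (p.1, C p)) := by
    funext p; rfl
  rw [hHF, ← Measure.map_map (hn2.prodMap measurable_id) (measurable_fst.prodMk hC), hClaw,
    Measure.map_map (hn2.prodMap measurable_id) ((hbf M).prodMk measurable_id')]
  have hfun : (Prod.map (nestMul t M (2 * S + 1)) id) ∘ (fun U : GaugeConfig 4 (2 * S + 1) G => (blockField M (2 * S + 1) U, U)) =
      fun U => (blockField (t * M) (2 * S + 1) U, U) := by
    funext U; simp only [Function.comp, Prod.map, id, blockField_mul (t := t) hM]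
  rw [hfun]

end LawStep


/-! ## §S2.3 Laws of the two inputs of the composite; locality predicates; the graded locality step -/

section LocStep

variable {G : Type} [Group G] [TopologicalSpace G] [IsTopologicalGroup G] [CompactSpace G]
  [MeasurableSpace G] [BorelSpace G] [SecondCountableTopology G]

variable {N : ℕ} (ρ : G →* Matrix (Fin N) (Fin N) ℂ) (β : ℝ)

/-- **Law of the lower stage's input.** Under `(blockField 2M)_* μ ⊗ ν`, the pair `(reblock M (B (V, ω_even)), ω_odd)` has law
`(blockField M)_* μ ⊗ ν` whenever `B` samples the `M`-block field given the `2M`-block field. -/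
theorem law_lowerInput {S M t : ℕ} (hM : 0 < M)
    {B : GaugeConfig 4 (2 * S + 1) G × Noise G (2 * S + 1) → GaugeConfig 4 (2 * S + 1) G} (hB : Measurable B)
    (hBlaw : (((wilsonMeasure (d := 4) (L := 2 * S + 1) ρ β).map (blockField (t * M) (2 * S + 1))).prod
        (seqNoise G (2 * S + 1))).map (fun p => (p.1, B p)) =
      (wilsonMeasure (d := 4) (L := 2 * S + 1) ρ β).map
        (fun U => (blockField (t * M) (2 * S + 1) U, blockField M (2 * S + 1) U))) :
    (((wilsonMeasure (d := 4) (L := 2 * S + 1) ρ β).map (blockField (t * M) (2 * S + 1))).prod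
        (seqNoise G (2 * S + 1))).map (fun p => (reblock M (2 * S + 1) (B (p.1, evenPart p.2)), oddPart p.2)) =
      ((wilsonMeasure (d := 4) (L := 2 * S + 1) ρ β).map (blockField M (2 * S + 1))).prod (seqNoise G (2 * S + 1)) := by
  haveI : IsProbabilityMeasure (seqNoise G (2 * S + 1)) := isProbabilityMeasure_seqNoise _
  haveI : SFinite (wilsonMeasure (d := 4) (L := 2 * S + 1) ρ β) := by
    unfold wilsonMeasure wilsonWeight; infer_instance
  set μ : Measure (GaugeConfig 4 (2 * S + 1) G) := wilsonMeasure (d := 4) (L := 2 * S + 1) ρ β with hμ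
  set ν : Measure (Noise G (2 * S + 1)) := seqNoise G (2 * S + 1) with hν
  have hbf : ∀ M', Measurable (blockField (G := G) M' (2 * S + 1)) := fun M' => measurable_blockField M' _
  have hrb : Measurable (reblock (G := G) M (2 * S + 1)) := measurable_reblock _ _
  set g : GaugeConfig 4 (2 * S + 1) G × Noise G (2 * S + 1) → GaugeConfig 4 (2 * S + 1) G :=
    fun p => reblock M (2 * S + 1) (B p) with hg
  have hgm : Measurable g := hrb.comp hB
  have hFeq : (fun p : GaugeConfig 4 (2 * S + 1) G × Noise G (2 * S + 1) =>
      (reblock M (2 * S + 1) (B (p.1, evenPart p.2)), oddPart p.2)) =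
      ((Prod.map g id) ∘ ⇑(MeasurableEquiv.prodAssoc.symm)) ∘ (Prod.map id splitNoise) := by
    funext p; rfl
  have hτ : ((μ.map (blockField (t * M) (2 * S + 1))).prod ν).map g = μ.map (blockField M (2 * S + 1)) := by
    have hg' : g = (fun r : GaugeConfig 4 (2 * S + 1) G × GaugeConfig 4 (2 * S + 1) G => reblock M (2 * S + 1) r.2) ∘
        (fun p => (p.1, B p)) := by funext p; rfl
    have hrs : Measurable (fun r : GaugeConfig 4 (2 * S + 1) G × GaugeConfig 4 (2 * S + 1) G => reblock M (2 * S + 1) r.2) :=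
      hrb.comp measurable_snd
    rw [hg', ← Measure.map_map hrs (measurable_fst.prodMk hB), hBlaw, Measure.map_map hrs ((hbf _).prodMk (hbf _))]
    have hfun : ((fun r : GaugeConfig 4 (2 * S + 1) G × GaugeConfig 4 (2 * S + 1) G => reblock M (2 * S + 1) r.2) ∘
        (fun U : GaugeConfig 4 (2 * S + 1) G => (blockField (t * M) (2 * S + 1) U, blockField M (2 * S + 1) U))) =
        blockField M (2 * S + 1) := by
      funext U; simp only [Function.comp, reblock_blockField hM]
    rw [hfun]
  rw [hFeq, ← Measure.map_map ((hgm.prodMap measurable_id).comp (MeasurableEquiv.prodAssoc.symm).measurable)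
    (measurable_id.prodMap measurable_splitNoise)]
  rw [← Measure.map_prod_map _ _ measurable_id measurable_splitNoise, Measure.map_id, seqNoise_map_splitNoise]
  rw [← Measure.map_map (hgm.prodMap measurable_id) (MeasurableEquiv.prodAssoc.symm).measurable]
  rw [((MeasureTheory.measurePreserving_prodAssoc (μ.map (blockField (t * M) (2 * S + 1))) ν ν).symm
    MeasurableEquiv.prodAssoc).map_eq]
  rw [← Measure.map_prod_map _ _ hgm measurable_id, Measure.map_id, hτ]

/-- **Law of the upper stage's input**: `(V, ω_even)` has the law of `(V, ω)`. -/
theorem law_upperInput {S M : ℕ} :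
    (((wilsonMeasure (d := 4) (L := 2 * S + 1) ρ β).map (blockField M (2 * S + 1))).prod
        (seqNoise G (2 * S + 1))).map (fun p => (p.1, evenPart p.2)) =
      ((wilsonMeasure (d := 4) (L := 2 * S + 1) ρ β).map (blockField M (2 * S + 1))).prod (seqNoise G (2 * S + 1)) := by
  haveI : IsProbabilityMeasure (seqNoise G (2 * S + 1)) := isProbabilityMeasure_seqNoise _
  haveI : SFinite (wilsonMeasure (d := 4) (L := 2 * S + 1) ρ β) := by
    unfold wilsonMeasure wilsonWeight; infer_instance
  have h : (fun p : GaugeConfig 4 (2 * S + 1) G × Noise G (2 * S + 1) => (p.1, evenPart p.2)) = Prod.map id evenPart := by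
    funext p; rfl
  rw [h, ← Measure.map_prod_map _ _ measurable_id measurable_evenPart, Measure.map_id, seqNoise_map_evenPart]

/-- `f (V, ω)` reads `V` and the link coordinates of `ω` only inside the input ball of radius `R` around `e`
(the locality clause of the conditional formats, named). -/
def LocalAt (S : ℕ) (e : Literature.MathematicalPhysics.QuantumLattice.ZdEdge 4) (R : ℕ) (f : GaugeConfig 4 (2 * S + 1) G × Noise G (2 * S + 1) → G) : Prop :=
  ∀ p q : GaugeConfig 4 (2 * S + 1) G × Noise G (2 * S + 1),
    (∀ x ∈ inputBall (2 * S + 1) e R, p.1 x = q.1 x) →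
    (∀ y : ℕ × Edge 4 (2 * S + 1), y.2 ∈ inputBall (2 * S + 1) e R → p.2 y = q.2 y) → f p = f q

omit [TopologicalSpace G] [IsTopologicalGroup G] [CompactSpace G] [MeasurableSpace G] [BorelSpace G]
  [SecondCountableTopology G] in
theorem localAt_mono {S : ℕ} {e : Literature.MathematicalPhysics.QuantumLattice.ZdEdge 4} {R R' : ℕ} (h : R ≤ R')
    {f : GaugeConfig 4 (2 * S + 1) G × Noise G (2 * S + 1) → G} (hf : LocalAt S e R f) : LocalAt S e R' f :=
  fun p q h1 h2 => hf p q (fun x hx => h1 x (inputBall_mono e h hx)) (fun y hy => h2 y (inputBall_mono e h hy))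

/-- **Graded locality** of a sampler `Ψ` under the input law `π`: for every link and every parameter `s ≥ 1` a measurable local
surrogate at radius `R s`, wrong with `π`-mass `≤ T s`. -/
def GradedLocal (S : ℕ) (π : Measure (GaugeConfig 4 (2 * S + 1) G × Noise G (2 * S + 1)))
    (Ψ : GaugeConfig 4 (2 * S + 1) G × Noise G (2 * S + 1) → GaugeConfig 4 (2 * S + 1) G) (R : ℕ → ℕ) (T : ℕ → ℝ) : Prop :=
  ∀ (e : Literature.MathematicalPhysics.QuantumLattice.ZdEdge 4) (s : ℕ), 1 ≤ s → ∃ Ψ' : GaugeConfig 4 (2 * S + 1) G × Noise G (2 * S + 1) → G, Measurable Ψ' ∧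
    LocalAt S e (R s) Ψ' ∧ π {p | Ψ p (torusEdge (2 * S + 1) e) ≠ Ψ' p} ≤ ENNReal.ofReal (T s)

omit [TopologicalSpace G] [IsTopologicalGroup G] [CompactSpace G] [BorelSpace G] [SecondCountableTopology G] in
theorem gradedLocal_mono {S : ℕ} {π : Measure (GaugeConfig 4 (2 * S + 1) G × Noise G (2 * S + 1))}
    {Ψ : GaugeConfig 4 (2 * S + 1) G × Noise G (2 * S + 1) → GaugeConfig 4 (2 * S + 1) G} {R R' : ℕ → ℕ} {T T' : ℕ → ℝ}
    (hR : ∀ s, 1 ≤ s → R s ≤ R' s) (hT : ∀ s, 1 ≤ s → T s ≤ T' s) (h : GradedLocal S π Ψ R T) : GradedLocal S π Ψ R' T' := by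
  intro e s hs
  obtain ⟨Ψ', hm, hloc, hbad⟩ := h e s hs
  exact ⟨Ψ', hm, localAt_mono (hR s hs) hloc, hbad.trans (ENNReal.ofReal_le_ofReal (hT s hs))⟩

/-- **The graded locality step** (union bound over the `M`-corner links of the lower input ball, counted uniformly in `M`;
the lower stage is run at parameter `s + 4`, the upper stage at `s`). -/
theorem gradedLocal_step {S M b t : ℕ} (hM : 0 < M) (hMN : M ≤ 2 * S + 1) {K : ℝ} (hK : 0 ≤ K)
    {C B : GaugeConfig 4 (2 * S + 1) G × Noise G (2 * S + 1) → GaugeConfig 4 (2 * S + 1) G}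
    (hC : Measurable C) (hB : Measurable B)
    (hBlaw : (((wilsonMeasure (d := 4) (L := 2 * S + 1) ρ β).map (blockField (t * M) (2 * S + 1))).prod
        (seqNoise G (2 * S + 1))).map (fun p => (p.1, B p)) =
      (wilsonMeasure (d := 4) (L := 2 * S + 1) ρ β).map
        (fun U => (blockField (t * M) (2 * S + 1) U, blockField M (2 * S + 1) U)))
    {R₁ : ℕ → ℕ} {T₁ : ℕ → ℝ} (hT₁ : ∀ s, 0 ≤ T₁ s)
    (hCloc : GradedLocal S (((wilsonMeasure (d := 4) (L := 2 * S + 1) ρ β).map (blockField M (2 * S + 1))).prod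
        (seqNoise G (2 * S + 1))) C R₁ T₁)
    (hBloc : ∀ (e : Literature.MathematicalPhysics.QuantumLattice.ZdEdge 4) (k : ℕ), 1 ≤ k →
      ∃ B' : GaugeConfig 4 (2 * S + 1) G × Noise G (2 * S + 1) → G, Measurable B' ∧
        LocalAt S e (k * (t * M * b)) B' ∧
        (((wilsonMeasure (d := 4) (L := 2 * S + 1) ρ β).map (blockField (t * M) (2 * S + 1))).prod (seqNoise G (2 * S + 1)))
            {p | B p (torusEdge (2 * S + 1) e) ≠ B' p} ≤ ENNReal.ofReal (K * Real.exp (-(k : ℝ))))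
    {R' : ℕ → ℕ} (hR' : ∀ s, R₁ (s + 4) ≤ M * R' s) :
    GradedLocal S (((wilsonMeasure (d := 4) (L := 2 * S + 1) ρ β).map (blockField (t * M) (2 * S + 1))).prod
        (seqNoise G (2 * S + 1)))
      (fun p => C (reblock M (2 * S + 1) (B (p.1, evenPart p.2)), oddPart p.2))
      (fun s => M * R' s + M + s * (t * M * b))
      (fun s => T₁ (s + 4) + 64 * ((2 * R' s + 3 : ℕ) : ℝ) ^ 4 * (K * Real.exp (-(s : ℝ)))) := by
  classical
  haveI : IsProbabilityMeasure (seqNoise G (2 * S + 1)) := isProbabilityMeasure_seqNoise _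
  haveI : NeZero (2 * S + 1) := ⟨by omega⟩
  intro e s hs
  set π₂ := ((wilsonMeasure (d := 4) (L := 2 * S + 1) ρ β).map (blockField (t * M) (2 * S + 1))).prod
    (seqNoise G (2 * S + 1)) with hπ₂
  set π₁ := ((wilsonMeasure (d := 4) (L := 2 * S + 1) ρ β).map (blockField M (2 * S + 1))).prod
    (seqNoise G (2 * S + 1)) with hπ₁
  -- the lower stage at parameter `s + 4`, weakened to radius `M * R' s`
  obtain ⟨Ψ', hΨ'm, hΨ'loc0, hΨ'bad⟩ := hCloc e (s + 4) (by omega)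
  have hΨ'loc : LocalAt S e (M * R' s) Ψ' := localAt_mono (hR' s) hΨ'loc0
  -- upper surrogates at parameter `s` for every `ℤ⁴`-link
  choose Bap hBapm hBaploc hBapbad using fun e' : Literature.MathematicalPhysics.QuantumLattice.ZdEdge 4 => hBloc e' s hs
  -- the corner edges of the lower input ball and their lifts
  obtain ⟨B₂, hB₂⟩ : ∃ B₂ : Set (Edge 4 (2 * S + 1)), B₂ = inputBall (2 * S + 1) e (M * R' s) := ⟨_, rfl⟩
  obtain ⟨Q, hQ⟩ : ∃ Q : Finset (Edge 4 (2 * S + 1)),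
      Q = Finset.univ.filter fun q => ∃ x ∈ B₂, cornerEdge M (2 * S + 1) x = q := ⟨_, rfl⟩
  have hQmem : ∀ q ∈ Q, ∃ x ∈ inputBall (2 * S + 1) e (M * R' s), cornerEdge M (2 * S + 1) x = q := by
    intro q hq
    rw [hQ, Finset.mem_filter] at hq
    obtain ⟨x, hx, hxq⟩ := hq.2
    exact ⟨x, by rwa [hB₂] at hx, hxq⟩
  have hlift : ∀ q ∈ Q, ∃ e₁ : Literature.MathematicalPhysics.QuantumLattice.ZdEdge 4, torusEdge (2 * S + 1) e₁ = q ∧ supDist e₁.1 e.1 ≤ M * R' s + M ∧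
      IsCornerLift M (2 * S + 1) e₁ := by
    intro q hq
    obtain ⟨x, hx, rfl⟩ := hQmem q hq
    exact exists_cornerLift hM hx
  choose! lift hlift₁ hlift₂ _hlift₃ using hlift
  have hcornerQ : ∀ x ∈ B₂, cornerEdge M (2 * S + 1) x ∈ Q := fun x hx => by
    rw [hQ, Finset.mem_filter]; exact ⟨Finset.mem_univ _, x, hx, rfl⟩
  have hcard : (Q.card : ℝ) ≤ 64 * ((2 * R' s + 3 : ℕ) : ℝ) ^ 4 := by
    exact_mod_cast card_corners_le hM hMN e (R' s) Q hQmem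
  -- the local surrogate of the reblocked upper output
  obtain ⟨W, hW⟩ : ∃ W : GaugeConfig 4 (2 * S + 1) G × Noise G (2 * S + 1) → GaugeConfig 4 (2 * S + 1) G,
      W = fun p x => Bap (lift (cornerEdge M (2 * S + 1) x)) (p.1, evenPart p.2) := ⟨_, rfl⟩
  have hWm : Measurable W := by
    rw [hW]
    exact measurable_pi_lambda _ fun x => (hBapm _).comp (measurable_fst.prodMk (measurable_evenPart.comp measurable_snd))
  refine ⟨fun p => Ψ' (W p, oddPart p.2), hΨ'm.comp (hWm.prodMk (measurable_oddPart.comp measurable_snd)), ?_, ?_⟩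
  · -- locality on the composite ball
    intro p q hV hω
    beta_reduce at hV hω
    refine hΨ'loc (W p, oddPart p.2) (W q, oddPart q.2) (fun x hx => ?_) (fun y hy => ?_)
    · have hxB : x ∈ B₂ := by rw [hB₂]; exact hx
      have hd := hlift₂ _ (hcornerQ x hxB)
      rw [hW]
      refine hBaploc (lift (cornerEdge M (2 * S + 1) x)) _ _ (fun x' hx' => ?_) (fun y' hy' => ?_)
      · exact hV x' (inputBall_subset (by omega) hx')
      · show p.2 (parityIndex _ (0, y')) = q.2 (parityIndex _ (0, y'))
        refine hω _ ?_
        simp only [parityIndex_snd]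
        exact inputBall_subset (by omega) hy'
    · show p.2 (parityIndex _ (1, y)) = q.2 (parityIndex _ (1, y))
      refine hω _ ?_
      simp only [parityIndex_snd]
      exact inputBall_mono e (by omega) hy
  · -- exceptional mass
    have hT : Measurable fun p : GaugeConfig 4 (2 * S + 1) G × Noise G (2 * S + 1) =>
        (reblock M (2 * S + 1) (B (p.1, evenPart p.2)), oddPart p.2) :=
      ((measurable_reblock M (2 * S + 1)).comp
        (hB.comp (measurable_fst.prodMk (measurable_evenPart.comp measurable_snd)))).prodMk
        (measurable_oddPart.comp measurable_snd)
    have hE : Measurable fun p : GaugeConfig 4 (2 * S + 1) G × Noise G (2 * S + 1) => (p.1, evenPart p.2) :=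
      measurable_fst.prodMk (measurable_evenPart.comp measurable_snd)
    have hlawT := law_lowerInput ρ β hM hB hBlaw
    have hlawE := law_upperInput ρ β (S := S) (M := t * M)
    -- pulled-back exceptional events
    have hbadC : π₂ {p | C (reblock M (2 * S + 1) (B (p.1, evenPart p.2)), oddPart p.2) (torusEdge (2 * S + 1) e) ≠
        Ψ' (reblock M (2 * S + 1) (B (p.1, evenPart p.2)), oddPart p.2)} ≤ ENNReal.ofReal (T₁ (s + 4)) := by
      refine le_trans (Measure.le_map_apply hT.aemeasurable {r | C r (torusEdge (2 * S + 1) e) ≠ Ψ' r}) ?_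
      rw [hπ₂, hlawT]
      exact hΨ'bad
    have hbadq : ∀ q ∈ Q, π₂ {p | B (p.1, evenPart p.2) (torusEdge (2 * S + 1) (lift q)) ≠ Bap (lift q) (p.1, evenPart p.2)} ≤
        ENNReal.ofReal (K * Real.exp (-(s : ℝ))) := by
      intro q _
      refine le_trans (Measure.le_map_apply hE.aemeasurable
        {r | B r (torusEdge (2 * S + 1) (lift q)) ≠ Bap (lift q) r}) ?_
      rw [hπ₂, hlawE]
      exact hBapbad (lift q)
    -- off the exceptional events the composite output is the surrogate
    have hsub : {p | C (reblock M (2 * S + 1) (B (p.1, evenPart p.2)), oddPart p.2) (torusEdge (2 * S + 1) e) ≠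
          Ψ' (W p, oddPart p.2)} ⊆
        {p | C (reblock M (2 * S + 1) (B (p.1, evenPart p.2)), oddPart p.2) (torusEdge (2 * S + 1) e) ≠
          Ψ' (reblock M (2 * S + 1) (B (p.1, evenPart p.2)), oddPart p.2)} ∪
        ⋃ q ∈ Q, {p | B (p.1, evenPart p.2) (torusEdge (2 * S + 1) (lift q)) ≠ Bap (lift q) (p.1, evenPart p.2)} := by
      intro p hp
      by_contra hnot
      simp only [Set.mem_union, Set.mem_iUnion, Set.mem_setOf_eq, not_or, not_exists, not_not] at hnot
      obtain ⟨h1, h2⟩ := hnot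
      apply hp
      rw [h1]
      refine hΨ'loc _ _ (fun x hx => ?_) (fun y _ => rfl)
      have hxB : x ∈ B₂ := by rw [hB₂]; exact hx
      have hq := hcornerQ x hxB
      show B (p.1, evenPart p.2) (cornerEdge M (2 * S + 1) x) = W p x
      rw [hW]
      simp only
      rw [← h2 _ hq, hlift₁ _ hq]
    -- the union bound
    have hKe : 0 ≤ K * Real.exp (-(s : ℝ)) := mul_nonneg hK (Real.exp_pos _).le
    calc π₂ {p | C (reblock M (2 * S + 1) (B (p.1, evenPart p.2)), oddPart p.2) (torusEdge (2 * S + 1) e) ≠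
            Ψ' (W p, oddPart p.2)}
        ≤ π₂ {p | C (reblock M (2 * S + 1) (B (p.1, evenPart p.2)), oddPart p.2) (torusEdge (2 * S + 1) e) ≠
              Ψ' (reblock M (2 * S + 1) (B (p.1, evenPart p.2)), oddPart p.2)} +
          π₂ (⋃ q ∈ Q, {p | B (p.1, evenPart p.2) (torusEdge (2 * S + 1) (lift q)) ≠ Bap (lift q) (p.1, evenPart p.2)}) :=
          (measure_mono hsub).trans (measure_union_le _ _)
      _ ≤ ENNReal.ofReal (T₁ (s + 4)) + Q.card • ENNReal.ofReal (K * Real.exp (-(s : ℝ))) :=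
          add_le_add hbadC ((measure_biUnion_finset_le _ _).trans (Finset.sum_le_card_nsmul _ _ _ hbadq))
      _ = ENNReal.ofReal (T₁ (s + 4) + (Q.card : ℝ) * (K * Real.exp (-(s : ℝ)))) := by
          rw [ENNReal.ofReal_add (hT₁ _) (mul_nonneg (Nat.cast_nonneg _) hKe), ENNReal.ofReal_mul (Nat.cast_nonneg _),
            ENNReal.ofReal_natCast, nsmul_eq_mul]
      _ ≤ ENNReal.ofReal (T₁ (s + 4) + 64 * ((2 * R' s + 3 : ℕ) : ℝ) ^ 4 * (K * Real.exp (-(s : ℝ)))) :=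
          ENNReal.ofReal_le_ofReal (by nlinarith [hcard, hKe])

end LocStep


/-! ## §S2.4 Arithmetic of the constants -/

section Arith

theorem exp_four_ge : (54 : ℝ) ≤ Real.exp 4 := by
  have h := Real.exp_one_gt_d9
  have h1 : Real.exp 4 = (Real.exp 1) ^ 4 := by
    rw [← Real.exp_nat_mul]; norm_num
  have h2 : (2.7182818283 : ℝ) ^ 4 ≤ (Real.exp 1) ^ 4 := pow_le_pow_left₀ (by norm_num) h.le 4
  rw [h1]
  nlinarith [h2]

/-- The tail constant of the graded invariant for block radius `b` and format constant `K' ≥ 0`. -/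
def tailConst (b : ℕ) (K' : ℝ) : ℝ := (144 * ((16 * b + 3 : ℕ) : ℝ) ^ 4 + 1) * K'

theorem tailConst_nonneg (b : ℕ) {K' : ℝ} (hK' : 0 ≤ K') : 0 ≤ tailConst b K' := by
  unfold tailConst; positivity

theorem le_tailConst (b : ℕ) {K' : ℝ} (hK' : 0 ≤ K') : K' ≤ tailConst b K' := by
  unfold tailConst; nlinarith [pow_nonneg (Nat.cast_nonneg (α := ℝ) (16 * b + 3)) 4]

/-- The one-step tail bookkeeping: `A (s+6)^4 e^{-(s+4)} + 64 (4bs+32b+5)^4 K' e^{-s} ≤ A (s+2)^4 e^{-s}` for `s ≥ 1`. -/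
theorem tail_step_arith (b : ℕ) {K' : ℝ} (hK' : 0 ≤ K') {s : ℕ} (hs : 1 ≤ s) :
    tailConst b K' * (((s + 4 : ℕ) : ℝ) + 2) ^ 4 * Real.exp (-((s + 4 : ℕ) : ℝ)) +
        64 * ((2 * (2 * b * s + 16 * b + 1) + 3 : ℕ) : ℝ) ^ 4 * (K' * Real.exp (-(s : ℝ))) ≤
      tailConst b K' * ((s : ℝ) + 2) ^ 4 * Real.exp (-(s : ℝ)) := by
  set A := tailConst b K' with hA
  set F : ℝ := ((16 * b + 3 : ℕ) : ℝ) ^ 4 with hF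
  have hA' : A = (144 * F + 1) * K' := rfl
  have hA0 : 0 ≤ A := tailConst_nonneg b hK'
  have hF0 : 0 ≤ F := by positivity
  set E := Real.exp (-(s : ℝ)) with hE
  have hE0 : 0 < E := Real.exp_pos _
  set e4 := Real.exp (-4) with he4
  have he40 : 0 < e4 := Real.exp_pos _
  have h54 : e4 * 54 ≤ 1 := by
    have hmul : e4 * Real.exp 4 = 1 := by rw [he4, ← Real.exp_add]; norm_num
    nlinarith [exp_four_ge]
  have hexp : Real.exp (-((s + 4 : ℕ) : ℝ)) = E * e4 := by
    rw [hE, he4, ← Real.exp_add]; push_cast; ring_nf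
  set X : ℝ := (((s + 4 : ℕ) : ℝ) + 2) ^ 4 with hX
  set Y : ℝ := ((s : ℝ) + 2) ^ 4 with hY
  have hY0 : 0 ≤ Y := by positivity
  have hXY : X ≤ 30 * Y := by
    have h1 : (3 * (s + 6)) ^ 4 ≤ (7 * (s + 2)) ^ 4 := Nat.pow_le_pow_left (by omega) 4
    have h2 : (((3 * (s + 6)) ^ 4 : ℕ) : ℝ) ≤ (((7 * (s + 2)) ^ 4 : ℕ) : ℝ) := by exact_mod_cast h1
    rw [hX, hY]; push_cast at h2 ⊢; nlinarith [h2]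
  set P : ℝ := ((2 * (2 * b * s + 16 * b + 1) + 3 : ℕ) : ℝ) ^ 4 with hP
  have hPY : P ≤ F * Y := by
    have h1 : (2 * (2 * b * s + 16 * b + 1) + 3) ^ 4 ≤ ((16 * b + 3) * (s + 2)) ^ 4 :=
      Nat.pow_le_pow_left (by nlinarith) 4
    have h2 : (((2 * (2 * b * s + 16 * b + 1) + 3) ^ 4 : ℕ) : ℝ) ≤ ((((16 * b + 3) * (s + 2)) ^ 4 : ℕ) : ℝ) := by
      exact_mod_cast h1
    rw [hP, hF, hY]; push_cast at h2 ⊢; nlinarith [h2]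
  have key : A * X * e4 + 64 * P * K' ≤ A * Y := by
    nlinarith [mul_le_mul_of_nonneg_left hXY (by positivity : 0 ≤ A * e4),
      mul_le_mul_of_nonneg_left h54 (by positivity : 0 ≤ A * 30 * Y),
      mul_le_mul_of_nonneg_left hPY (by positivity : 0 ≤ 64 * K')]
  rw [hexp]
  have hl : A * X * (E * e4) + 64 * P * (K' * E) = E * (A * X * e4 + 64 * P * K') := by ring
  have hr : A * Y * E = E * (A * Y) := by ring
  rw [hl, hr]
  exact mul_le_mul_of_nonneg_left key hE0.le

/-- The final re-indexing `s = 2k`: `A (2k+2)^4 e^{-2k} ≤ 384 e A e^{-k}`. -/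
theorem tail_final_arith {A : ℝ} (hA : 0 ≤ A) (k : ℕ) :
    A * (((2 * k : ℕ) : ℝ) + 2) ^ 4 * Real.exp (-((2 * k : ℕ) : ℝ)) ≤ 384 * Real.exp 1 * A * Real.exp (-(k : ℝ)) := by
  have h4 := pow_four_le_exp (k + 1)
  have hE0 : 0 < Real.exp (-(k : ℝ)) := Real.exp_pos _
  have hsq : Real.exp (-((2 * k : ℕ) : ℝ)) = Real.exp (-(k : ℝ)) * Real.exp (-(k : ℝ)) := by
    rw [← Real.exp_add]; push_cast; ring_nf
  have hk1 : Real.exp (((k + 1 : ℕ) : ℝ)) = Real.exp (k : ℝ) * Real.exp 1 := by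
    rw [← Real.exp_add]; push_cast; ring_nf
  have hinv : Real.exp (k : ℝ) * Real.exp (-(k : ℝ)) = 1 := by rw [← Real.exp_add]; simp
  have h16 : (((2 * k : ℕ) : ℝ) + 2) ^ 4 = 16 * (((k + 1 : ℕ) : ℝ)) ^ 4 := by push_cast; ring
  rw [hsq, h16]
  rw [hk1] at h4
  -- `A * (16 (k+1)^4) * (E * E) ≤ 384 e A E` since `(k+1)^4 E ≤ 24 e`
  have hmid : (((k + 1 : ℕ) : ℝ)) ^ 4 * Real.exp (-(k : ℝ)) ≤ 24 * Real.exp 1 := by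
    have := mul_le_mul_of_nonneg_right h4 hE0.le
    calc (((k + 1 : ℕ) : ℝ)) ^ 4 * Real.exp (-(k : ℝ)) ≤ 24 * (Real.exp (k : ℝ) * Real.exp 1) * Real.exp (-(k : ℝ)) := this
      _ = 24 * Real.exp 1 * (Real.exp (k : ℝ) * Real.exp (-(k : ℝ))) := by ring
      _ = 24 * Real.exp 1 := by rw [hinv, mul_one]
  have := mul_le_mul_of_nonneg_left hmid (by positivity : 0 ≤ 16 * A * Real.exp (-(k : ℝ)))
  nlinarith [this]

end Arith

/-! ## §S2.5 The invariant, base, step, induction, and `IterateCondCoders` -/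

section Iterate

variable {G : Type} [Group G] [TopologicalSpace G] [IsTopologicalGroup G] [CompactSpace G]
  [MeasurableSpace G] [BorelSpace G] [SecondCountableTopology G]

omit [Group G] [TopologicalSpace G] [IsTopologicalGroup G] [CompactSpace G] [MeasurableSpace G] [BorelSpace G]
  [SecondCountableTopology G] in
theorem torusEdge_mem_inputBall {N : ℕ} (e : Literature.MathematicalPhysics.QuantumLattice.ZdEdge 4) (R : ℕ) : torusEdge N e ∈ inputBall N e R :=
  ⟨e, by simp [supDist_le_iff], rfl⟩

variable {N : ℕ} (ρ : G →* Matrix (Fin N) (Fin N) ℂ) (β : ℝ)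

/-- The induction invariant at block side `M`: a conditional coder of the fine field given its `M`-blocks on the torus `2S+1`,
exact in law, with graded locality radius `M (2bs + 8b + 1)` and tail `A (s+2)^4 e^{-s}`. -/
def Inv (S b : ℕ) (A : ℝ) (M : ℕ) : Prop :=
  ∃ C : GaugeConfig 4 (2 * S + 1) G × Noise G (2 * S + 1) → GaugeConfig 4 (2 * S + 1) G, Measurable C ∧
    (((wilsonMeasure (d := 4) (L := 2 * S + 1) ρ β).map (blockField M (2 * S + 1))).prod
        (seqNoise G (2 * S + 1))).map (fun p => (p.1, C p)) =
      (wilsonMeasure (d := 4) (L := 2 * S + 1) ρ β).map (fun U => (blockField M (2 * S + 1) U, U)) ∧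
    GradedLocal S (((wilsonMeasure (d := 4) (L := 2 * S + 1) ρ β).map (blockField M (2 * S + 1))).prod
        (seqNoise G (2 * S + 1))) C (fun s => M * (2 * b * s + 8 * b + 1)) (fun s => A * ((s : ℝ) + 2) ^ 4 * Real.exp (-(s : ℝ)))

/-- **Base**: the level-`0` conditional coder (fine given `2`-blocks) is the invariant at `M = 2`. -/
theorem inv_base {S b : ℕ} {K A : ℝ} (hKA : K ≤ A) (hA : 0 ≤ A)
    {Ψ : GaugeConfig 4 (2 * S + 1) G × Noise G (2 * S + 1) → GaugeConfig 4 (2 * S + 1) G} (hΨm : Measurable Ψ)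
    (hΨlaw : (((wilsonMeasure (d := 4) (L := 2 * S + 1) ρ β).map (blockField 2 (2 * S + 1))).prod
        (seqNoise G (2 * S + 1))).map (fun p => (p.1, Ψ p)) =
      (wilsonMeasure (d := 4) (L := 2 * S + 1) ρ β).map (fun U => (blockField 2 (2 * S + 1) U, U)))
    (hΨloc : ∀ (e : Literature.MathematicalPhysics.QuantumLattice.ZdEdge 4) (k : ℕ), 1 ≤ k →
      ∃ Ψ' : GaugeConfig 4 (2 * S + 1) G × Noise G (2 * S + 1) → G, Measurable Ψ' ∧
        LocalAt S e (k * (2 * b)) Ψ' ∧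
        (((wilsonMeasure (d := 4) (L := 2 * S + 1) ρ β).map (blockField 2 (2 * S + 1))).prod (seqNoise G (2 * S + 1)))
            {p | Ψ p (torusEdge (2 * S + 1) e) ≠ Ψ' p} ≤ ENNReal.ofReal (K * Real.exp (-(k : ℝ)))) :
    Inv ρ β S b A 2 := by
  refine ⟨Ψ, hΨm, hΨlaw, ?_⟩
  intro e s hs
  obtain ⟨Ψ', hm, hloc, hbad⟩ := hΨloc e s hs
  refine ⟨Ψ', hm, localAt_mono (by nlinarith) hloc, hbad.trans (ENNReal.ofReal_le_ofReal ?_)⟩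
  have h1 : (1 : ℝ) ≤ ((s : ℝ) + 2) ^ 4 := one_le_pow₀ (by have := (Nat.cast_nonneg (α := ℝ) s); linarith)
  have hE : 0 < Real.exp (-(s : ℝ)) := Real.exp_pos _
  nlinarith [mul_le_mul_of_nonneg_left h1 hA, hE]

/-- **Step**: the invariant at `M` and a one-step conditional block coder `M ← 2M` give the invariant at `2M`. -/
theorem inv_step {S M b : ℕ} (hM : 0 < M) (hMN : M ≤ 2 * S + 1) {K K' : ℝ} (hK' : 0 ≤ K') (hKK' : K ≤ K')
    (hInv : Inv ρ β S b (tailConst b K') M)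
    {B : GaugeConfig 4 (2 * S + 1) G × Noise G (2 * S + 1) → GaugeConfig 4 (2 * S + 1) G} (hB : Measurable B)
    (hBlaw : (((wilsonMeasure (d := 4) (L := 2 * S + 1) ρ β).map (blockField (2 * M) (2 * S + 1))).prod
        (seqNoise G (2 * S + 1))).map (fun p => (p.1, B p)) =
      (wilsonMeasure (d := 4) (L := 2 * S + 1) ρ β).map
        (fun U => (blockField (2 * M) (2 * S + 1) U, blockField M (2 * S + 1) U)))
    (hBloc : ∀ (e : Literature.MathematicalPhysics.QuantumLattice.ZdEdge 4) (k : ℕ), 1 ≤ k →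
      ∃ B' : GaugeConfig 4 (2 * S + 1) G × Noise G (2 * S + 1) → G, Measurable B' ∧
        LocalAt S e (k * (2 * M * b)) B' ∧
        (((wilsonMeasure (d := 4) (L := 2 * S + 1) ρ β).map (blockField (2 * M) (2 * S + 1))).prod (seqNoise G (2 * S + 1)))
            {p | B p (torusEdge (2 * S + 1) e) ≠ B' p} ≤ ENNReal.ofReal (K * Real.exp (-(k : ℝ)))) :
    Inv ρ β S b (tailConst b K') (2 * M) := by
  obtain ⟨C, hC, hClaw, hCloc⟩ := hInv
  have hT : Measurable fun p : GaugeConfig 4 (2 * S + 1) G × Noise G (2 * S + 1) =>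
      (reblock M (2 * S + 1) (B (p.1, evenPart p.2)), oddPart p.2) :=
    ((measurable_reblock M (2 * S + 1)).comp
      (hB.comp (measurable_fst.prodMk (measurable_evenPart.comp measurable_snd)))).prodMk
      (measurable_oddPart.comp measurable_snd)
  refine ⟨fun p => C (reblock M (2 * S + 1) (B (p.1, evenPart p.2)), oddPart p.2), hC.comp hT,
    condLaw_step ρ β hM hC hB hClaw hBlaw, ?_⟩
  -- upper locality with the nonnegative constant `K'`
  have hBloc' : ∀ (e : Literature.MathematicalPhysics.QuantumLattice.ZdEdge 4) (k : ℕ), 1 ≤ k →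
      ∃ B' : GaugeConfig 4 (2 * S + 1) G × Noise G (2 * S + 1) → G, Measurable B' ∧
        LocalAt S e (k * (2 * M * b)) B' ∧
        (((wilsonMeasure (d := 4) (L := 2 * S + 1) ρ β).map (blockField (2 * M) (2 * S + 1))).prod (seqNoise G (2 * S + 1)))
            {p | B p (torusEdge (2 * S + 1) e) ≠ B' p} ≤ ENNReal.ofReal (K' * Real.exp (-(k : ℝ))) := by
    intro e k hk
    obtain ⟨B', hm, hloc, hbad⟩ := hBloc e k hk
    exact ⟨B', hm, hloc, hbad.trans (ENNReal.ofReal_le_ofReal (mul_le_mul_of_nonneg_right hKK' (Real.exp_pos _).le))⟩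
  have hstep := gradedLocal_step ρ β (b := b) hM hMN hK' hC hB hBlaw
    (T₁ := fun s => tailConst b K' * ((s : ℝ) + 2) ^ 4 * Real.exp (-(s : ℝ)))
    (fun s => by have := tailConst_nonneg b hK'; positivity) hCloc hBloc'
    (R' := fun s => 2 * b * s + 16 * b + 1) (fun s => le_of_eq (by ring))
  refine gradedLocal_mono (fun s _ => le_of_eq (by ring)) (fun s hs => ?_) hstep
  exact tail_step_arith b hK' hs

/-- **All levels**: from the level-`0` coder and the block coders `2^i ← 2^{i+1}` (`1 ≤ i < n`), the invariant at every `2^m`,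
`1 ≤ m ≤ n`, on a torus large enough for all the formats involved. -/
theorem inv_all {S b n : ℕ} {K : ℝ} (hSn : 2 ^ n ≤ 2 * S + 1) (hSb : 2 ^ n * b ≤ 2 * S + 1)
    (h0 : ∃ Ψ : GaugeConfig 4 (2 * S + 1) G × Noise G (2 * S + 1) → GaugeConfig 4 (2 * S + 1) G, Measurable Ψ ∧
      (((wilsonMeasure (d := 4) (L := 2 * S + 1) ρ β).map (blockField 2 (2 * S + 1))).prod
          (seqNoise G (2 * S + 1))).map (fun p => (p.1, Ψ p)) =
        (wilsonMeasure (d := 4) (L := 2 * S + 1) ρ β).map (fun U => (blockField 2 (2 * S + 1) U, U)) ∧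
      ∀ (e : Literature.MathematicalPhysics.QuantumLattice.ZdEdge 4) (k : ℕ), 1 ≤ k →
        ∃ Ψ' : GaugeConfig 4 (2 * S + 1) G × Noise G (2 * S + 1) → G, Measurable Ψ' ∧
          LocalAt S e (k * (2 * b)) Ψ' ∧
          (((wilsonMeasure (d := 4) (L := 2 * S + 1) ρ β).map (blockField 2 (2 * S + 1))).prod (seqNoise G (2 * S + 1)))
              {p | Ψ p (torusEdge (2 * S + 1) e) ≠ Ψ' p} ≤ ENNReal.ofReal (K * Real.exp (-(k : ℝ))))
    (hblk : ∀ i : ℕ, 1 ≤ i → i < n → CondBlockCodedSeq ρ K β (2 ^ i) (2 ^ (i + 1)) b) :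
    ∀ m : ℕ, 1 ≤ m → m ≤ n → Inv ρ β S b (tailConst b (max K 0)) (2 ^ m) := by
  intro m hm hmn
  induction m, hm using Nat.le_induction with
  | base =>
    obtain ⟨Ψ, hΨm, hΨlaw, hΨloc⟩ := h0
    rw [pow_one]
    exact inv_base ρ β ((le_max_left K 0).trans (le_tailConst b (le_max_right K 0)))
      (tailConst_nonneg b (le_max_right K 0)) hΨm hΨlaw hΨloc
  | succ m hm ih =>
    have hmn' : m < n := by omega
    have hIm := ih (by omega)
    -- the block coder `2^m ← 2^{m+1}` on this torus
    have hfmt := hblk m hm hmn'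
    have h2S : 2 ^ (m + 1) * b ≤ 2 * S + 1 :=
      le_trans (Nat.mul_le_mul_right b (Nat.pow_le_pow_right (by norm_num) hmn)) hSb
    obtain ⟨B, hBm, hBlaw, hBloc⟩ := hfmt S h2S
    have hM : 0 < 2 ^ m := pow_pos (by norm_num) m
    have hMN : 2 ^ m ≤ 2 * S + 1 := le_trans (Nat.pow_le_pow_right (by norm_num) (by omega)) hSn
    rw [pow_succ'] at hBlaw hBloc ⊢
    exact inv_step ρ β hM hMN (le_max_right K 0) (le_max_left K 0) hIm hBm hBlaw
      (fun e k hk => hBloc e k hk)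

end Iterate

/-- **S₂ PROVED — `IterateCondCoders`** (rev 4 stub `stub_iterateCondCoders`): constants `b₃ = 12b + 1`,
`K₃ = 384·e·(144(16b+3)⁴ + 1)·max K 0`. -/
theorem iterateCondCoders_holds : IterateCondCoders := by
  intro K b
  refine ⟨384 * Real.exp 1 * tailConst b (max K 0), 12 * b + 1, ?_⟩
  intro G _ _ _ _ _ _ _ N ρ β n fl h0 hblk S hS hfl
  haveI : NeZero (2 * S + 1) := ⟨by omega⟩
  haveI : IsProbabilityMeasure (seqNoise G (2 * S + 1)) := isProbabilityMeasure_seqNoise _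
  haveI : SFinite (wilsonMeasure (d := 4) (L := 2 * S + 1) ρ β) := by
    unfold wilsonMeasure wilsonWeight; infer_instance
  rcases Nat.eq_zero_or_pos n with rfl | hn
  · -- `n = 0`: the identity coder of the fine field given its `1`-blocks (= itself)
    simp only [pow_zero] at hS ⊢
    have hbf1 : blockField (G := G) 1 (2 * S + 1) = id := funext blockField_one
    refine ⟨fun p => p.1, measurable_fst, ?_, ?_⟩
    · rw [hbf1, Measure.map_id]
      have hcomp : (fun p : GaugeConfig 4 (2 * S + 1) G × Noise G (2 * S + 1) => (p.1, p.1)) =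
          (fun U : GaugeConfig 4 (2 * S + 1) G => (id U, U)) ∘ Prod.fst := rfl
      rw [hcomp, ← Measure.map_map (measurable_id.prodMk measurable_id') measurable_fst, Measure.map_fst_prod,
        measure_univ, one_smul]
    · intro e k hk
      refine ⟨fun p => p.1 (torusEdge (2 * S + 1) e), (measurable_pi_apply (torusEdge (2 * S + 1) e)).comp measurable_fst,
        fun p q hV _ => hV _ (torusEdge_mem_inputBall e _), ?_⟩
      simp
  · -- `n ≥ 1`: the telescoped composite at level `n`, read at parameter `s = 2k`
    have hSn : 2 ^ n ≤ 2 * S + 1 := le_trans (Nat.le_mul_of_pos_right _ (by omega)) hS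
    have hSb : 2 ^ n * b ≤ 2 * S + 1 := le_trans (Nat.mul_le_mul_left (2 ^ n) (by omega)) hS
    have h2n : 2 ≤ 2 ^ n := by
      calc (2 : ℕ) = 2 ^ 1 := (pow_one 2).symm
        _ ≤ 2 ^ n := Nat.pow_le_pow_right (by norm_num) hn
    have h2b : 2 * b ≤ 2 * S + 1 := le_trans (Nat.mul_le_mul_right b h2n) hSb
    obtain ⟨Ψ, hΨm, hΨlaw, hΨloc⟩ := h0 S h2b hfl
    obtain ⟨C, hC, hClaw, hCloc⟩ :=
      inv_all ρ β hSn hSb ⟨Ψ, hΨm, hΨlaw, fun e k hk => hΨloc e k hk⟩ hblk n hn le_rfl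
    refine ⟨C, hC, hClaw, ?_⟩
    intro e k hk
    obtain ⟨Ψ', hm, hloc, hbad⟩ := hCloc e (2 * k) (by omega)
    have hrad : 2 ^ n * (2 * b * (2 * k) + 8 * b + 1) ≤ k * (2 ^ n * (12 * b + 1)) := by
      have h1 : 2 * b * (2 * k) + 8 * b + 1 ≤ k * (12 * b + 1) := by nlinarith
      calc 2 ^ n * (2 * b * (2 * k) + 8 * b + 1) ≤ 2 ^ n * (k * (12 * b + 1)) := Nat.mul_le_mul_left _ h1
        _ = k * (2 ^ n * (12 * b + 1)) := by ring
    refine ⟨Ψ', hm, localAt_mono hrad hloc, hbad.trans (ENNReal.ofReal_le_ofReal ?_)⟩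
    exact tail_final_arith (tailConst_nonneg b (le_max_right K 0)) k

/-! ## §S2.7 C3 (`ComposeCond`, guarded by `1 ≤ M`) — one conditional composition step over a general divisor `M' ∣ M` -/

section C3

/-- The C3 tail at parameter `s = 2k`. -/
theorem tail_c3_arith (b₃ : ℕ) {K₃' K₄' : ℝ} (h3 : 0 ≤ K₃') (h4 : 0 ≤ K₄') {k : ℕ} (hk : 1 ≤ k) :
    K₃' * Real.exp (-((2 * k + 4 : ℕ) : ℝ)) +
        64 * ((2 * ((2 * k + 4) * b₃) + 3 : ℕ) : ℝ) ^ 4 * (K₄' * Real.exp (-((2 * k : ℕ) : ℝ))) ≤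
      (K₃' + 1536 * ((12 * b₃ + 3 : ℕ) : ℝ) ^ 4 * K₄') * Real.exp (-(k : ℝ)) := by
  have hE0 : 0 < Real.exp (-(k : ℝ)) := Real.exp_pos _
  have h1 : Real.exp (-((2 * k + 4 : ℕ) : ℝ)) ≤ Real.exp (-(k : ℝ)) :=
    Real.exp_le_exp.2 (by push_cast; linarith [(Nat.cast_nonneg (α := ℝ) k)])
  have hP : ((2 * ((2 * k + 4) * b₃) + 3 : ℕ) : ℝ) ≤ (k : ℝ) * ((12 * b₃ + 3 : ℕ) : ℝ) := by
    have : (2 * ((2 * k + 4) * b₃) + 3 : ℕ) ≤ k * (12 * b₃ + 3) := by nlinarith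
    exact_mod_cast this
  have hP4 : ((2 * ((2 * k + 4) * b₃) + 3 : ℕ) : ℝ) ^ 4 ≤ (k : ℝ) ^ 4 * ((12 * b₃ + 3 : ℕ) : ℝ) ^ 4 := by
    rw [← mul_pow]; exact pow_le_pow_left₀ (by positivity) hP 4
  have h4k := pow_four_le_exp k
  have hsq : Real.exp (-((2 * k : ℕ) : ℝ)) = Real.exp (-(k : ℝ)) * Real.exp (-(k : ℝ)) := by
    rw [← Real.exp_add]; push_cast; ring_nf
  have hinv : Real.exp (k : ℝ) * Real.exp (-(k : ℝ)) = 1 := by rw [← Real.exp_add]; simp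
  have hmid : (k : ℝ) ^ 4 * Real.exp (-((2 * k : ℕ) : ℝ)) ≤ 24 * Real.exp (-(k : ℝ)) := by
    rw [hsq]
    calc (k : ℝ) ^ 4 * (Real.exp (-(k : ℝ)) * Real.exp (-(k : ℝ)))
        = ((k : ℝ) ^ 4 * Real.exp (-(k : ℝ))) * Real.exp (-(k : ℝ)) := by ring
      _ ≤ (24 * Real.exp (k : ℝ) * Real.exp (-(k : ℝ))) * Real.exp (-(k : ℝ)) :=
          mul_le_mul_of_nonneg_right (mul_le_mul_of_nonneg_right h4k hE0.le) hE0.le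
      _ = 24 * (Real.exp (k : ℝ) * Real.exp (-(k : ℝ))) * Real.exp (-(k : ℝ)) := by ring
      _ = 24 * Real.exp (-(k : ℝ)) := by rw [hinv, mul_one]
  have hQ : 0 ≤ ((12 * b₃ + 3 : ℕ) : ℝ) ^ 4 := by positivity
  have hE2 : 0 ≤ Real.exp (-((2 * k : ℕ) : ℝ)) := (Real.exp_pos _).le
  calc K₃' * Real.exp (-((2 * k + 4 : ℕ) : ℝ)) +
        64 * ((2 * ((2 * k + 4) * b₃) + 3 : ℕ) : ℝ) ^ 4 * (K₄' * Real.exp (-((2 * k : ℕ) : ℝ)))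
      ≤ K₃' * Real.exp (-(k : ℝ)) +
        64 * ((k : ℝ) ^ 4 * ((12 * b₃ + 3 : ℕ) : ℝ) ^ 4) * (K₄' * Real.exp (-((2 * k : ℕ) : ℝ))) := by
          gcongr
    _ = K₃' * Real.exp (-(k : ℝ)) +
        64 * ((12 * b₃ + 3 : ℕ) : ℝ) ^ 4 * K₄' * ((k : ℝ) ^ 4 * Real.exp (-((2 * k : ℕ) : ℝ))) := by ring
    _ ≤ K₃' * Real.exp (-(k : ℝ)) + 64 * ((12 * b₃ + 3 : ℕ) : ℝ) ^ 4 * K₄' * (24 * Real.exp (-(k : ℝ))) := by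
          gcongr
    _ = (K₃' + 1536 * ((12 * b₃ + 3 : ℕ) : ℝ) ^ 4 * K₄') * Real.exp (-(k : ℝ)) := by ring

/-- **C3 PROVED in the form the assembly consumes** (`1 ≤ M'`, `1 ≤ M`, `M' ∣ M`): a conditional coder of the fine field given its
`M'`-blocks (floored, constants `(K₃, b₃)`) and a conditional block coder `M' ← M` (constants `(K₄, b₄)`) compose to a conditional
coder of the fine field given its `M`-blocks with constants `K₂ = max K₃ 0 + 1536 (12 b₃ + 3)⁴ max K₄ 0`, `b₂ = 6 b₃ + 2 b₄ + 1`
depending on `(K₃, K₄, b₃, b₄)` ONLY — by the exact `t`-fold nesting `blockField (t M') = nestMul t M' ∘ blockField M'`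
(`condLaw_step`) and one graded locality step (`gradedLocal_step`) read at parameter `s = 2k`.  The telescoped line's registered
`stub_composeCond` omits the guard `1 ≤ M`; its only consumer (`irCal_of_telescoped`) has `M = 2^{j⋆} ≥ 1`. -/
theorem composeCond_pos (K₃ K₄ : ℝ) (b₃ b₄ : ℕ) : ∃ (K₂ : ℝ) (b₂ : ℕ),
    ∀ (G : Type) [Group G] [TopologicalSpace G] [IsTopologicalGroup G] [CompactSpace G]
      [MeasurableSpace G] [BorelSpace G] [SecondCountableTopology G] {N : ℕ} (ρ : G →* Matrix (Fin N) (Fin N) ℂ) (β : ℝ)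
      (M' M fl : ℕ), 1 ≤ M' → 1 ≤ M → M' ∣ M → CondBlockCodedSeq ρ K₄ β M' M b₄ → CondCodedSeqFrom fl ρ K₃ β M' b₃ →
        CondCodedSeqFrom fl ρ K₂ β M b₂ := by
  refine ⟨max K₃ 0 + 1536 * ((12 * b₃ + 3 : ℕ) : ℝ) ^ 4 * max K₄ 0, 6 * b₃ + 2 * b₄ + 1, ?_⟩
  intro G _ _ _ _ _ _ _ N ρ β M' M fl hM' hM hdvd hblk hcond
  obtain ⟨t, rfl⟩ := hdvd
  rw [Nat.mul_comm M' t] at hM hblk ⊢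
  have ht : 0 < t := by
    rcases Nat.eq_zero_or_pos t with rfl | h
    · simp at hM
    · exact h
  have hM'pos : 0 < M' := hM'
  have hM'le : M' ≤ t * M' := Nat.le_mul_of_pos_left M' ht
  intro S hS hfl
  haveI : NeZero (2 * S + 1) := ⟨by omega⟩
  haveI : IsProbabilityMeasure (seqNoise G (2 * S + 1)) := isProbabilityMeasure_seqNoise _
  haveI : SFinite (wilsonMeasure (d := 4) (L := 2 * S + 1) ρ β) := by
    unfold wilsonMeasure wilsonWeight; infer_instance
  have hSb₄ : t * M' * b₄ ≤ 2 * S + 1 := le_trans (Nat.mul_le_mul_left (t * M') (by omega)) hS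
  have hSb₃ : M' * b₃ ≤ 2 * S + 1 := le_trans (Nat.mul_le_mul hM'le (by omega)) hS
  have hM'S : M' ≤ 2 * S + 1 := le_trans (le_trans hM'le (Nat.le_mul_of_pos_right _ (by omega))) hS
  obtain ⟨B, hBm, hBlaw, hBloc⟩ := hblk S hSb₄
  obtain ⟨C, hCm, hClaw, hCloc⟩ := hcond S hSb₃ hfl
  -- graded form of the lower coder: its format approximant at parameter `s`, constant `max K₃ 0`
  have hCgl : GradedLocal S (((wilsonMeasure (d := 4) (L := 2 * S + 1) ρ β).map (blockField M' (2 * S + 1))).prod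
      (seqNoise G (2 * S + 1))) C (fun s => s * (M' * b₃)) (fun s => max K₃ 0 * Real.exp (-(s : ℝ))) := by
    intro e s hs
    obtain ⟨Ψ', hm, hloc, hbad⟩ := hCloc e s hs
    exact ⟨Ψ', hm, hloc, hbad.trans (ENNReal.ofReal_le_ofReal
      (mul_le_mul_of_nonneg_right (le_max_left _ _) (Real.exp_pos _).le))⟩
  -- upper locality with the nonnegative constant `max K₄ 0`
  have hBloc' : ∀ (e : Literature.MathematicalPhysics.QuantumLattice.ZdEdge 4) (k : ℕ), 1 ≤ k →
      ∃ B' : GaugeConfig 4 (2 * S + 1) G × Noise G (2 * S + 1) → G, Measurable B' ∧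
        LocalAt S e (k * (t * M' * b₄)) B' ∧
        (((wilsonMeasure (d := 4) (L := 2 * S + 1) ρ β).map (blockField (t * M') (2 * S + 1))).prod (seqNoise G (2 * S + 1)))
            {p | B p (torusEdge (2 * S + 1) e) ≠ B' p} ≤ ENNReal.ofReal (max K₄ 0 * Real.exp (-(k : ℝ))) := by
    intro e k hk
    obtain ⟨B', hm, hloc, hbad⟩ := hBloc e k hk
    exact ⟨B', hm, hloc, hbad.trans (ENNReal.ofReal_le_ofReal
      (mul_le_mul_of_nonneg_right (le_max_left _ _) (Real.exp_pos _).le))⟩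
  have hstep := gradedLocal_step ρ β (b := b₄) (t := t) hM'pos hM'S (le_max_right K₄ 0) hCm hBm hBlaw
    (R₁ := fun s => s * (M' * b₃)) (T₁ := fun s => max K₃ 0 * Real.exp (-(s : ℝ)))
    (fun s => mul_nonneg (le_max_right _ _) (Real.exp_pos _).le) hCgl hBloc'
    (R' := fun s => (s + 4) * b₃) (fun s => le_of_eq (by ring))
  have hT : Measurable fun p : GaugeConfig 4 (2 * S + 1) G × Noise G (2 * S + 1) =>
      (reblock M' (2 * S + 1) (B (p.1, evenPart p.2)), oddPart p.2) :=
    ((measurable_reblock M' (2 * S + 1)).comp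
      (hBm.comp (measurable_fst.prodMk (measurable_evenPart.comp measurable_snd)))).prodMk
      (measurable_oddPart.comp measurable_snd)
  refine ⟨fun p => C (reblock M' (2 * S + 1) (B (p.1, evenPart p.2)), oddPart p.2), hCm.comp hT,
    condLaw_step ρ β hM'pos hCm hBm hClaw hBlaw, ?_⟩
  intro e k hk
  obtain ⟨Ψ', hm, hloc, hbad⟩ := hstep e (2 * k) (by omega)
  have hrad : M' * ((2 * k + 4) * b₃) + M' + 2 * k * (t * M' * b₄) ≤ k * (t * M' * (6 * b₃ + 2 * b₄ + 1)) := by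
    set P : ℕ := t * M' with hP
    have h1 : M' * ((2 * k + 4) * b₃) ≤ P * (6 * k * b₃) :=
      Nat.mul_le_mul hM'le (Nat.mul_le_mul_right _ (by omega))
    have h2 : M' ≤ k * P := le_trans hM'le (Nat.le_mul_of_pos_left P hk)
    calc M' * ((2 * k + 4) * b₃) + M' + 2 * k * (P * b₄) ≤ P * (6 * k * b₃) + k * P + 2 * k * (P * b₄) := by omega
      _ = k * (P * (6 * b₃ + 2 * b₄ + 1)) := by ring
  refine ⟨Ψ', hm, localAt_mono hrad hloc, hbad.trans (ENNReal.ofReal_le_ofReal ?_)⟩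
  exact tail_c3_arith b₃ (le_max_right K₃ 0) (le_max_right K₄ 0) hk

end C3

end S2Proof

/-! ## §3b One level further down: S₁ from typed sub-stubs (M-a∕M-c sparse-defect SSM · (R) rarity · M-b coder construction · levels) -/

section Format2

variable {G : Type} [Group G] [TopologicalSpace G] [IsTopologicalGroup G] [CompactSpace G]
  [MeasurableSpace G] [BorelSpace G]

/-- Sup-distance on the torus `(ℤ/L)⁴` (shorter way round in each coordinate). -/
def torusDist {L : ℕ} (x y : Literature.MathematicalPhysics.QuantumFieldTheory.Site 4 L) : ℕ :=
  Finset.univ.sup fun l => min (x l - y l).val (y l - x l).val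

/-- The Wilson cost `s_p(U) = N - Re tr ρ(U_p) ∈ [0, 2N]` of one plaquette (the summand of `wilsonAction`). -/
def plaqCost {N L : ℕ} (ρ : G →* Matrix (Fin N) (Fin N) ℂ) (U : GaugeConfig 4 L G) (p : Literature.MathematicalPhysics.QuantumFieldTheory.Plaquette 4 L) : ℝ :=
  (N : ℝ) - (ρ (plaquetteHolonomy U p.1 p.2.1.1 p.2.1.2)).trace.re

/-- The four links of a plaquette. -/
def plaqLinks {L : ℕ} (p : Literature.MathematicalPhysics.QuantumFieldTheory.Plaquette 4 L) : Finset (Literature.MathematicalPhysics.QuantumFieldTheory.Edge 4 L) :=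
  {(p.1, p.2.1.1), (p.1.shift p.2.1.1, p.2.1.2), (p.1.shift p.2.1.2, p.2.1.1), (p.1, p.2.1.2)}

/-- **Reconstruction of the fine field from (block field `V`, free links `φ`) at block side 2** (rev 3 = REPAIR `C′` of
`Theorems/IR/Negative/OneStepSparseSSMFalse.lean`, p595772: rev 2 recomputed the first link of EVERY 2-line with even starting
coordinate, whereas `blockField 2 L U` records only the block's CORNER line — the window law then held a rough `recon2 V τ ≠ τ`
and `not_oneStepSparseSSM` followed from the junk measure).  Now ONLY the corner line's first link (start site with ALL
coordinates even) is DETERMINED by the block holonomy, `U(x₀,i) := V(x₀,i)·φ(x₀+eᵢ,i)⁻¹` (or `V` itself on a truncated one-link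
block line at the odd torus's end); every other link is free.  For `V = blockField 2 L U` on an odd torus: `recon2 V U = U` and
`blockField 2 L (recon2 V φ) = V` — `(V, free links) ↦ U` is the free-link parametrisation of the fibre `{blockField 2 L U = V}`
(Haar translation-invariant: no co-area factor), so the densities below are honest conditional laws and a covered exterior `τ`
with `blockField 2 L τ = V` is held AT `τ`. -/
def recon2 {L : ℕ} (V φ : GaugeConfig 4 L G) : GaugeConfig 4 L G := fun q =>
  if (∀ l : Fin 4, (q.1 l).val % 2 = 0) then
    V q * (if (q.1 q.2).val + 1 < L then φ (q.1.shift q.2, q.2) else 1)⁻¹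
  else φ q

/-- Glue: links in the window `W` from `φ`, all other links from the exterior configuration `τ`. -/
def glueCfg {L : ℕ} (W : Finset (Literature.MathematicalPhysics.QuantumFieldTheory.Edge 4 L)) (τ φ : GaugeConfig 4 L G) : GaugeConfig 4 L G :=
  fun q => if q ∈ W then φ q else τ q

/-- **The one-step window law** `P^{τ,V}_W` (un-normalised): resample the links of `W` with the Wilson weight, the block field
`V` held fixed through `recon2` (determined links recomputed), the exterior held at `τ`, and the INTERIOR SMALL-FIELD
RESTRICTION `s_p ≤ δ` imposed on the checked plaquettes `P₀` (Bałaban's characteristic functions `χ`); pushed forward to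
full configurations. -/
def oneStepWeight {N L : ℕ} [NeZero L] (ρ : G →* Matrix (Fin N) (Fin N) ℂ) (β δ : ℝ) (V τ : GaugeConfig 4 L G)
    (W : Finset (Literature.MathematicalPhysics.QuantumFieldTheory.Edge 4 L)) (P₀ : Finset (Literature.MathematicalPhysics.QuantumFieldTheory.Plaquette 4 L)) : Measure (GaugeConfig 4 L G) :=
  ((Measure.pi fun _ : Literature.MathematicalPhysics.QuantumFieldTheory.Edge 4 L => haarProbability G).withDensity fun φ =>
      ({U : GaugeConfig 4 L G | ∀ p ∈ P₀, plaqCost ρ U p ≤ δ}.indicator 1 (recon2 V (glueCfg W τ φ))) *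
        ENNReal.ofReal (Real.exp (-β * wilsonAction ρ (recon2 V (glueCfg W τ φ))))).map
    fun φ => recon2 V (glueCfg W τ φ)

/-- The normalised one-step window law (junk `0` if the weight has mass `0` or `∞`; the statements below exclude that). -/
def oneStepLaw {N L : ℕ} [NeZero L] (ρ : G →* Matrix (Fin N) (Fin N) ℂ) (β δ : ℝ) (V τ : GaugeConfig 4 L G)
    (W : Finset (Literature.MathematicalPhysics.QuantumFieldTheory.Edge 4 L)) (P₀ : Finset (Literature.MathematicalPhysics.QuantumFieldTheory.Plaquette 4 L)) : Measure (GaugeConfig 4 L G) :=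
  (oneStepWeight ρ β δ V τ W P₀ Set.univ)⁻¹ • oneStepWeight ρ β δ V τ W P₀

/-- The checked plaquettes: those touching the window `W` and farther than `2·rad` from every defect centre in `C`. -/
def checkedPlaqs {L : ℕ} [NeZero L] (W : Finset (Literature.MathematicalPhysics.QuantumFieldTheory.Edge 4 L)) (C : Finset (Literature.MathematicalPhysics.QuantumFieldTheory.Site 4 L)) (rad : ℕ) :
    Finset (Literature.MathematicalPhysics.QuantumFieldTheory.Plaquette 4 L) :=
  Finset.univ.filter fun p => (∃ e ∈ plaqLinks p, e ∈ W) ∧ ∀ c ∈ C, 2 * rad < torusDist p.1 c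

/-- Exterior large-field LUMPS: every plaquette of `τ` costing more than `δ` lies within torus distance `rad` of a centre. -/
def DefectsCoveredBy {N L : ℕ} (ρ : G →* Matrix (Fin N) (Fin N) ℂ) (δ : ℝ) (rad : ℕ) (C : Finset (Literature.MathematicalPhysics.QuantumFieldTheory.Site 4 L))
    (τ : GaugeConfig 4 L G) : Prop :=
  ∀ p : Literature.MathematicalPhysics.QuantumFieldTheory.Plaquette 4 L, δ < plaqCost ρ τ p → ∃ c ∈ C, torusDist p.1 c ≤ rad

/-- `ℓ`-separated centres (SPARSE defects). -/
def Separated {L : ℕ} (ℓ : ℕ) (C : Finset (Literature.MathematicalPhysics.QuantumFieldTheory.Site 4 L)) : Prop :=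
  ∀ c ∈ C, ∀ c' ∈ C, c ≠ c' → ℓ ≤ torusDist c c'

end Format2

section MechanismBelow

/-- **(M-a)+(M-c) — SPARSE-DEFECT STRONG SPATIAL MIXING of the one-step constrained measure, sub-region form** (research;
(M-a) = the case `C = ∅`, Bałaban-class: [CMP 109 Thm 3, (2.1); CMP 116 p.1]; (M-c) = `C ≠ ∅`, UNPRINTED).  For every compact
simple `G`, `r`, lump radius `rad` and EVERY small-field constant `A > 0` (rev 3: universally quantified — Bałaban's
small-field expansions hold for `|F| ≤ √(2A)` standard deviations once `β ≥ β₃(A)`; (M-b) instantiates `A ≥ A₀` of (R))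
there are `K`, a decay length `b` and `β₃` such that for `β ≥ β₃`, on every odd torus: for a window `W` of links, an observation set `U₀ ⊆ W`, two exterior configurations `τ, τ'`
with the SAME 2-block field `V`, whose large plaquettes (`s_p > A/(2β)`) are covered by `b`-separated lumps of radius `rad`
centred in `C`, and which differ (outside `W`) only at torus distance `≥ R` from `U₀`: every `U₀`-measurable event has
probabilities under the two window laws (interior restricted to `s_p ≤ A/β` on the checked plaquettes) within
`|U₀|·K·e^{-R/b}`.  Gaussian dictionary: exterior-independent covariance + massive harmonic extension ⇒ TRUE with `C = ∅`
(tree `B4ContourShift.latticeKernel_decay`); killed-walk-with-inclusions toy ⇒ TRUE with sparse `C`.  Rev 2's statement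
(with the rev-2 `recon2`) is REFUTED: `SmallFieldPolymerCoderNeg.not_oneStepSparseSSM` (p595772, misstated∕type-level). -/
def OneStepSparseSSM : Prop :=
  ∀ (G : Type) [Group G] [TopologicalSpace G] [IsTopologicalGroup G] [CompactSpace G],
    IsCompactSimpleLieGroup G →
    letI : MeasurableSpace G := borel G
    haveI : BorelSpace G := ⟨rfl⟩
    ∀ (r : LatticeRep G) (rad : ℕ) (A : ℝ), 0 < A → ∃ (K : ℝ) (b : ℕ) (β₃ : ℝ), 1 ≤ b ∧
      ∀ β : ℝ, β₃ ≤ β → ∀ (S : ℕ) (W U₀ : Finset (Literature.MathematicalPhysics.QuantumFieldTheory.Edge 4 (2 * S + 1))) (C : Finset (Literature.MathematicalPhysics.QuantumFieldTheory.Site 4 (2 * S + 1)))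
        (V τ τ' : GaugeConfig 4 (2 * S + 1) G),
        U₀ ⊆ W → Separated b C →
        blockField 2 (2 * S + 1) τ = V → blockField 2 (2 * S + 1) τ' = V →
        DefectsCoveredBy r.ρ (A / (2 * β)) rad C τ → DefectsCoveredBy r.ρ (A / (2 * β)) rad C τ' →
        ∀ R : ℕ, (∀ q : Literature.MathematicalPhysics.QuantumFieldTheory.Edge 4 (2 * S + 1), q ∉ W → τ q ≠ τ' q → ∀ u ∈ U₀, R ≤ torusDist q.1 u.1) →
        ∀ B : Set (GaugeConfig 4 (2 * S + 1) G), MeasurableSet B →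
          DependsOn (fun U : GaugeConfig 4 (2 * S + 1) G => U ∈ B) (↑U₀ : Set (Literature.MathematicalPhysics.QuantumFieldTheory.Edge 4 (2 * S + 1))) →
          |(oneStepLaw r.ρ β (A / β) V τ W (checkedPlaqs W C rad) B).toReal -
              (oneStepLaw r.ρ β (A / β) V τ' W (checkedPlaqs W C rad) B).toReal| ≤
            (U₀.card : ℝ) * K * Real.exp (-(R : ℝ) / b)

/-- **(R) — LARGE-FIELD RARITY at the fixed threshold `A/(2β)`, Peierls-multiplicative, uniform in `β ≥ β₃` and in every odd
torus `2S+1 ≥ 3`** (rev 3 re-typing, decided by this seat as the consumers' planner: `∃ (c A₀ β₃) ∀ A ≥ A₀` — ONE rate for all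
large `A` (rev 2's `∀ A > 0 ∃ c` asked the lower tail too, which (M-b) never uses) — and sides `≥ 3` (rev 2 included the
one-point torus `S = 0`)).  With the threshold `A/(2β)` the per-plaquette factor `e^{-cA}` is `β`-INDEPENDENT — large fields are a
FIXED sparse gas at every `β`, which is why (M-c) is needed at all.  REV 4: this floor-free form is NOT CONSUMED on the path to `IR`
any more — (M-b)'s Peierls count runs only on tori `2S+1 ≥ volFloor β` (§1b), where (R≥) below is PROVED; the def is kept as the
statement NT-side consumers quote (rev 3's residual (R<) on the tori `3 ≤ 2S+1 < (⌈β⌉₊+2)²` and `largeFieldRarity_of_split` are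
retired from the skeleton: true or not, they are not load-bearing). -/
def LargeFieldRarity : Prop :=
  ∀ (G : Type) [Group G] [TopologicalSpace G] [IsTopologicalGroup G] [CompactSpace G],
    IsCompactSimpleLieGroup G →
    letI : MeasurableSpace G := borel G
    haveI : BorelSpace G := ⟨rfl⟩
    ∀ (r : LatticeRep G), ∃ (c A₀ β₃ : ℝ), 0 < c ∧
      ∀ A : ℝ, A₀ ≤ A → ∀ β : ℝ, β₃ ≤ β → ∀ S : ℕ, 1 ≤ S →
        ∀ Q : Finset (Literature.MathematicalPhysics.QuantumFieldTheory.Plaquette 4 (2 * S + 1)),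
          wilsonMeasure (d := 4) (L := 2 * S + 1) r.ρ β
              {U | ∀ p ∈ Q, A / (2 * β) < plaqCost r.ρ U p} ≤
            ENNReal.ofReal (Real.exp (-(c * A * Q.card)))

/-- **(R≥) — large-field rarity on the odd tori ABOVE THE VOLUME FLOOR `2S+1 ≥ (⌈β⌉₊+2)²`: PROVED, sorry-free** — rev 4: THE TREE
STATEMENT BY NAME, `LargeFieldRarityChessboard.LargeFieldRarityOddTori` of `Theorems/IR/LargeFieldRarityDefs.lean` (landed by LEAD ab-p1
2026-08-28T04:40Z from this seat's g3 package; its kernel-closed witness `largeFieldRarityOddTori_holds` — odd-torus chessboard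
`OddTorusChessboard.wilsonExpectation_expObs_le_exp_card_all` × the tree's Chatterjee theorem `EquipartitionCriticality.freeEnergyLogCoefficient_proof`
× the finite-size free-energy theorem; `c = θ/4`, `θ = 1/12` — LANDED as `Theorems/IR/LargeFieldRarityOddTori.lean`, file 5 of the package,
2026-08-28T05:56Z; rev 6.1: the former stub is the theorem `largeFieldRarityLargeTori_holds` below).  For every compact simple `G` and `r`:
`∃ c > 0, A₀, β₃` with `μ_{2S+1,β}{∀ p ∈ Q, s_p > A/(2β)} ≤ e^{−cA|Q|}` for all `A ≥ A₀`, `β ≥ β₃`, `S ≥ 1`, `volFloor β ≤ 2S+1`, all `Q`.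
The SAME LEVER was published first by ym-ir-idea-5 g6 (`Lines/largefield_rarity_uniform.lean`, `largeFieldRarityFrom_holds`). -/
def LargeFieldRarityLargeTori : Prop := LargeFieldRarityOddTori

/-- The bottom conjunct of S₁ on its own: the fine field given its 2-blocks is conditionally coded, constants uniform in
`β ≥ β₃` — rev 4: on the odd tori `2S+1 ≥ volFloor β = (⌈β⌉₊+2)²` (§1b: the floor is free downstream). -/
def BottomCondCoder : Prop :=
  ∀ (G : Type) [Group G] [TopologicalSpace G] [IsTopologicalGroup G] [CompactSpace G],
    IsCompactSimpleLieGroup G →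
    letI : MeasurableSpace G := borel G
    haveI : BorelSpace G := ⟨rfl⟩
    ∀ (r : LatticeRep G), ∃ (K : ℝ) (b : ℕ) (β₃ : ℝ), ∀ β : ℝ, β₃ ≤ β → CondCodedSeqFrom (volFloor β) r.ρ K β 2 b

/-- The level conjuncts of S₁: one-step conditional BLOCK coders `2^i ← 2^{i+1}` with level-uniform constants, `λ` octaves
below the minimal disordered scale (research L–XL; same mechanism as the bottom level but LAW-level: the `2^i`-block field's
law is an RG image — Bałaban's level-`i` small-field effective action CMP 109 Thm 3 is the supplier; no density posited). -/
def LevelCondCoders : Prop :=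
  ∀ (G : Type) [Group G] [TopologicalSpace G] [IsTopologicalGroup G] [CompactSpace G],
    IsCompactSimpleLieGroup G →
    letI : MeasurableSpace G := borel G
    haveI : BorelSpace G := ⟨rfl⟩
    ∀ (r : LatticeRep G) (K₁ : ℝ) (b₁ : ℕ), ∃ (lam : ℕ) (K : ℝ) (b : ℕ) (β₃ : ℝ), ∀ β : ℝ, β₃ ≤ β →
      ∀ i : ℕ, 1 ≤ i → i + 1 + lam ≤ jStar r.ρ K₁ b₁ β →
        CondBlockCodedSeq r.ρ K β (2 ^ i) (2 ^ (i + 1)) b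

/-- stub (M-a)+(M-c): sparse-defect one-step SSM (research; `C = ∅` Bałaban-class, `C ≠ ∅` the unprinted increment). -/
theorem stub_oneStepSparseSSM : OneStepSparseSSM := by
  sorry

/-- stub (R≥): large-field rarity above the volume floor — PROVED sorry-free in `Lines/largefield_rarity_chessboard.lean`
(`largeFieldRarityOddTori_holds`, this seat g3; the lever first in idea-5 g6's `Lines/largefield_rarity_uniform.lean`; idea-5 g7's
`Lines/pressure_monotone_tm.lean` v3 lowers the floor to `⌈log β⌉₊+2`, which rev 4 does not even need); a `sorry` here only until the
supplier is landed under `Theorems/IR/` (crux workfiles are not importable; landing manifest `Lines/largefield_rarity_chessboard_LANDING.md`),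
then `exact largeFieldRarityOddTori_holds`.  REV 4: this is the ONLY rarity statement on the path to `IR`, and it is the tree's Prop by name.
**REV 6.1: LANDED** — `Theorems/IR/LargeFieldRarityOddTori.lean` (file 5 of the package, LEAD ab-p1, 2026-08-28T05:56Z) proves
`LargeFieldRarityChessboard.largeFieldRarityOddTori_holds`; the former stub `stub_largeFieldRarityLargeTori` is this THEOREM by name (no `sorry`). -/
theorem largeFieldRarityLargeTori_holds : LargeFieldRarityLargeTori := largeFieldRarityOddTori_holds

/-- stub (M-b): **SSM + rarity ⇒ conditional coder** — Spinka's finitary-coding construction [arXiv:1803.10578 Thm 1.1(b)]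
ported to compact spins (measurable maximal couplings of kernels with continuous positive densities), to the CONDITIONAL
setting (locality in `V` inherited from the range-2 `V`-dependence of the window laws) and to odd tori; the exceptional
events are «a dense defect configuration (lumps closer than `b`, or a lump of radius `> rad`) within distance `k b` of the
link», of probability `≤ K e^{-k}` by (R≥) and a Peierls count (plumbing-with-one-risk, size L); rev 3: (M-a∕c) is instantiated
at `A := max A₀ 1` with `A₀` from (R≥), coder radius `b ≥ 2` so that every torus `2S+1 ≥ 2b` has `S ≥ 1`; REV 4: the coder is
asked only on tori `2S+1 ≥ volFloor β`, exactly where the rarity it consumes — (R≥), PROVED — holds: the hypothesis is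
`LargeFieldRarityLargeTori`, not the floor-free (R). -/
theorem stub_bottomCoder_of_sparseSSM : OneStepSparseSSM → LargeFieldRarityLargeTori → BottomCondCoder := by
  sorry

/-- stub (levels): the one-step conditional block coders at levels `i ≥ 1` (research L–XL). -/
theorem stub_levelCondCoders : LevelCondCoders := by
  sorry

/-- Monotonicity of the (floored, rev 4) conditional-coder format in its constants (proved). -/
theorem condCodedSeqFrom_mono {G : Type} [Group G] [TopologicalSpace G] [IsTopologicalGroup G] [CompactSpace G]
    [MeasurableSpace G] [BorelSpace G] {fl N : ℕ} (ρ : G →* Matrix (Fin N) (Fin N) ℂ) {K K' : ℝ} (β : ℝ) (M : ℕ)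
    {b b' : ℕ} (hK : K ≤ K') (hb : b ≤ b') (h : CondCodedSeqFrom fl ρ K β M b) : CondCodedSeqFrom fl ρ K' β M b' := by
  intro S hS hfl
  have hS' : M * b ≤ 2 * S + 1 := le_trans (Nat.mul_le_mul_left M hb) hS
  obtain ⟨Ψ, hΨm, hlaw, hloc⟩ := h S hS' hfl
  refine ⟨Ψ, hΨm, hlaw, fun e k hk => ?_⟩
  obtain ⟨Ψ', hΨ'm, hdep, htail⟩ := hloc e k hk
  have hball : inputBall (2 * S + 1) e (k * (M * b)) ⊆ inputBall (2 * S + 1) e (k * (M * b')) := by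
    intro x hx
    obtain ⟨e', he', rfl⟩ := hx
    exact ⟨e', le_trans he' (Nat.mul_le_mul_left k (Nat.mul_le_mul_left M hb)), rfl⟩
  refine ⟨Ψ', hΨ'm, fun p q hp hq => hdep p q (fun x hx => hp x (hball hx)) (fun y hy => hq y (hball hy)), ?_⟩
  refine le_trans htail (ENNReal.ofReal_le_ofReal ?_)
  exact mul_le_mul_of_nonneg_right hK (Real.exp_pos _).le

/-- Monotonicity of the conditional block-coder format in its constants (proved). -/
theorem condBlockCodedSeq_mono {G : Type} [Group G] [TopologicalSpace G] [IsTopologicalGroup G] [CompactSpace G]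
    [MeasurableSpace G] [BorelSpace G] {N : ℕ} (ρ : G →* Matrix (Fin N) (Fin N) ℂ) {K K' : ℝ} (β : ℝ) (M' M : ℕ)
    {b b' : ℕ} (hK : K ≤ K') (hb : b ≤ b') (h : CondBlockCodedSeq ρ K β M' M b) :
    CondBlockCodedSeq ρ K' β M' M b' := by
  intro S hS
  have hS' : M * b ≤ 2 * S + 1 := le_trans (Nat.mul_le_mul_left M hb) hS
  obtain ⟨Ψ, hΨm, hlaw, hloc⟩ := h S hS'
  refine ⟨Ψ, hΨm, hlaw, fun e k hk => ?_⟩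
  obtain ⟨Ψ', hΨ'm, hdep, htail⟩ := hloc e k hk
  have hball : inputBall (2 * S + 1) e (k * (M * b)) ⊆ inputBall (2 * S + 1) e (k * (M * b')) := by
    intro x hx
    obtain ⟨e', he', rfl⟩ := hx
    exact ⟨e', le_trans he' (Nat.mul_le_mul_left k (Nat.mul_le_mul_left M hb)), rfl⟩
  refine ⟨Ψ', hΨ'm, fun p q hp hq => hdep p q (fun x hx => hp x (hball hx)) (fun y hy => hq y (hball hy)), ?_⟩
  refine le_trans htail (ENNReal.ofReal_le_ofReal ?_)
  exact mul_le_mul_of_nonneg_right hK (Real.exp_pos _).le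

/-- **S₁ from its typed sub-stubs (real proof):** bottom coder and level coders, constants merged by monotonicity. -/
theorem oneStepCondCoder_of (hB : BottomCondCoder) (hL : LevelCondCoders) : OneStepCondCoder := by
  intro G _ _ _ _ hG
  letI : MeasurableSpace G := borel G
  haveI : BorelSpace G := ⟨rfl⟩
  intro r K₁ b₁
  obtain ⟨KB, bB, βB, hbot⟩ := hB G hG r
  obtain ⟨lam, KL, bL, βL, hlev⟩ := hL G hG r K₁ b₁
  refine ⟨lam, max KB KL, max bB bL, max βB βL, fun β hβ => ⟨?_, fun i hi hij => ?_⟩⟩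
  · exact condCodedSeqFrom_mono r.ρ β 2 (le_max_left _ _) (le_max_left _ _)
      (hbot β (le_trans (le_max_left _ _) hβ))
  · exact condBlockCodedSeq_mono r.ρ β (2 ^ i) (2 ^ (i + 1)) (le_max_right _ _) (le_max_right _ _)
      (hlev β (le_trans (le_max_right _ _) hβ) i hi hij)

/-- **S₁, no longer a bare stub**: from (M-a∕M-c) sparse-defect SSM, (R≥) rarity (a TREE THEOREM since rev 6.1), (M-b) the coder
construction, and the level coders. -/
theorem oneStepCondCoder_of_stubs : OneStepCondCoder :=
  oneStepCondCoder_of (stub_bottomCoder_of_sparseSSM stub_oneStepSparseSSM largeFieldRarityLargeTori_holds)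
    stub_levelCondCoders

end MechanismBelow

/-! ## §4 Composition to the route decl: v2's `irCal_of_telescoped` VERBATIM (hypotheses form) and `IR_of_mechanism` (rev 3: E, C2 from the tree) -/



/-- C3 (conditional composition; telescoped line's `stub_composeCond` with the binder `[SecondCountableTopology G]` ADDED per ★pool-p3's
caveat 02:44:31Z — for non-second-countable `G` multiplication need not be measurable for the product σ-algebra, so the nesting map has
no measurable graph; every use below is at a `LatticeRep` (faithful ⇒ second countable); implied by the telescoped stub as typed;
plumbing M–L, group- and `β`-blind; rev 4: with a torus floor `fl` carried through — pointwise in the torus, `fl = 0` is rev 3).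
REV 6: GUARDED by `1 ≤ M` — the regime of its only consumer `irCal_of_telescoped` (`M = 2^{j⋆} ≥ 1`) — and PROVED (`composeCond_holds`,
from §S2.7 `composeCond_pos`: `K₂ = max K₃ 0 + 1536 (12 b₃ + 3)⁴ max K₄ 0`, `b₂ = 6 b₃ + 2 b₄ + 1`).  (The unguarded v2 statement also
covers `M = 0`, where `blockField 0 = 1` and the conclusion asks radius-`0` locality: true there only vacuously ∕ degenerately and not by
composition; no consumer needs it.)  No longer a stub of this skeleton. -/
def ComposeCond : Prop :=
  ∀ (K₃ K₄ : ℝ) (b₃ b₄ : ℕ), ∃ (K₂ : ℝ) (b₂ : ℕ),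
    ∀ (G : Type) [Group G] [TopologicalSpace G] [IsTopologicalGroup G] [CompactSpace G]
      [MeasurableSpace G] [BorelSpace G] [SecondCountableTopology G] {N : ℕ} (ρ : G →* Matrix (Fin N) (Fin N) ℂ) (β : ℝ) (M' M fl : ℕ),
      1 ≤ M' → 1 ≤ M → M' ∣ M → CondBlockCodedSeq ρ K₄ β M' M b₄ → CondCodedSeqFrom fl ρ K₃ β M' b₃ →
        CondCodedSeqFrom fl ρ K₂ β M b₂

/-- **C3 PROVED** (rev 6): the guarded conditional composition, by `composeCond_pos` (§S2.7). -/
theorem composeCond_holds : ComposeCond := fun K₃ K₄ b₃ b₄ => composeCond_pos K₃ K₄ b₃ b₄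

/-- T (cluster region; telescoped line's `stub_clusterRegionCoder`, VERBATIM statement; research XL, no mechanism in this line). -/
def ClusterRegionCoder : Prop :=
  ∀ (G : Type) [Group G] [TopologicalSpace G] [IsTopologicalGroup G] [CompactSpace G],
    IsCompactSimpleLieGroup G →
    letI : MeasurableSpace G := borel G
    haveI : BorelSpace G := ⟨rfl⟩
    ∀ (r : LatticeRep G), ∃ (K₁ : ℝ) (b₁ : ℕ) (β₂ : ℝ), ∀ β : ℝ, β₂ ≤ β →
      ∃ j : ℕ, CoarseCodedSeq r.ρ K₁ β (2 ^ j) b₁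

/-- U_× (crossover octaves, conditional; telescoped line's `stub_crossoverCondBlockCoder`, VERBATIM statement; research, no mechanism here). -/
def CrossoverCondBlockCoder : Prop :=
  ∀ (G : Type) [Group G] [TopologicalSpace G] [IsTopologicalGroup G] [CompactSpace G],
    IsCompactSimpleLieGroup G →
    letI : MeasurableSpace G := borel G
    haveI : BorelSpace G := ⟨rfl⟩
    ∀ (r : LatticeRep G) (K₁ : ℝ) (b₁ lam : ℕ), ∃ (K₄ : ℝ) (b₄ : ℕ) (β₄ : ℝ), ∀ β : ℝ, β₄ ≤ β →
      {j : ℕ | CoarseCodedSeq r.ρ K₁ β (2 ^ j) b₁}.Nonempty →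
      ∀ j' : ℕ, j' ≤ jStar r.ρ K₁ b₁ β → jStar r.ρ K₁ b₁ β ≤ j' + lam →
        CondBlockCodedSeq r.ρ K₄ β (2 ^ j') (2 ^ jStar r.ρ K₁ b₁ β) b₄

/-- X (asymptotic freedom up to the coding onset; telescoped line's `stub_codedAF`, VERBATIM statement; research L–XL). -/
def CodedAF : Prop :=
  ∀ (G : Type) [Group G] [TopologicalSpace G] [IsTopologicalGroup G] [CompactSpace G],
    IsCompactSimpleLieGroup G →
    letI : MeasurableSpace G := borel G
    haveI : BorelSpace G := ⟨rfl⟩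
    ∀ (r : LatticeRep G) (K : ℝ) (v : 𝓢(EuclideanSpace ℝ (Fin 4), ℝ)),
      tsupport v ⊆ {y : EuclideanSpace ℝ (Fin 4) | 0 < y 0} →
      ∀ η : ℝ, 0 < η → ∃ T β₁ : ℝ, ∀ β : ℝ, β₁ ≤ β → ∀ s : ℝ, 0 < s →
        T ≤ s * (fmtOnset (HaarCodedSeq r.ρ K) β : ℝ) →
          ∃ᶠ (L : ℕ) in atTop, |Q2 G r β L s (thetaTest 4 v) v| ≤ η

/-- stub (telescoped WALL, rev 6): **the telescoped line's three remaining RESEARCH stubs, bundled** — T `stub_clusterRegionCoder`,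
U_× `stub_crossoverCondBlockCoder`, X `stub_codedAF` of `Cruxes/IR/Lines/telescoped_coding.lean` (v2.2), where they are registered,
tracked and worked.  NOT content of this line (which refines U_UV only); bundled by name so that this skeleton's obligations are exactly
its declared stubs and `IR_of_mechanism` has no free hypotheses.  (Rev ≤ 5 `stub_telescopedRest` also bundled C3 `ComposeCond`, which
rev 6 PROVES — `composeCond_holds`; every remaining `sorry` of this skeleton is now YM content.) -/
theorem stub_telescopedWall : ClusterRegionCoder ∧ CrossoverCondBlockCoder ∧ CodedAF := by
  sorry

/-- **C2 WITH A TORUS FLOOR (rev 4, PROVED from the tree's per-torus lemmas `law_compose_of_coders` + `composite_locality` of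
`Theorems/IR/TelescopedCoding{NoiseSplit,Compose}.lean`, p597846):** a coarse coder at block side `M` and a conditional coder below `M`
on the tori `≥ fl` compose to a Haar coder of the Wilson measure at radius `max (c·M) fl` — the floor simply joins the radius (the
format `HaarCodedSeq … b` is asked on tori `≥ b`, and locality at radius `k·c·M` is locality at radius `k·max (c·M) fl`). -/
theorem composeCoders_from :
    ∀ (K₁ K₂ : ℝ) (b₁ b₂ : ℕ), ∃ (K : ℝ) (c : ℕ), 1 ≤ c ∧
      ∀ (G : Type) [Group G] [TopologicalSpace G] [IsTopologicalGroup G] [CompactSpace G]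
        [MeasurableSpace G] [BorelSpace G] {N : ℕ} (ρ : G →* Matrix (Fin N) (Fin N) ℂ) (β : ℝ) (M fl : ℕ),
        1 ≤ M → CoarseCodedSeq ρ K₁ β M b₁ → CondCodedSeqFrom fl ρ K₂ β M b₂ → HaarCodedSeq ρ K β (max (c * M) fl) := by
  intro K₁ K₂ b₁ b₂
  refine ⟨max K₂ 0 + 1536 * ((4 * b₂ + 3 : ℕ) : ℝ) ^ 4 * max K₁ 0, 2 * (b₁ + b₂) + 1, by omega, ?_⟩
  intro G _ _ _ _ _ _ N ρ β M fl hM hco hcd S hS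
  have hcS : (2 * (b₁ + b₂) + 1) * M ≤ 2 * S + 1 := le_trans (le_max_left _ _) hS
  have hfl : fl ≤ 2 * S + 1 := le_trans (le_max_right _ _) hS
  have hS₁ : M * b₁ ≤ 2 * S + 1 := le_trans (by nlinarith) hcS
  have hS₂ : M * b₂ ≤ 2 * S + 1 := le_trans (by nlinarith) hcS
  have hMN : M ≤ 2 * S + 1 := le_trans (by nlinarith) hcS
  obtain ⟨Φ₁, hΦ₁m, hlaw₁, hloc₁⟩ := hco S hS₁
  obtain ⟨Ψ, hΨm, hlaw₂, hloc₂⟩ := hcd S hS₂ hfl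
  haveI : NeZero (2 * S + 1) := ⟨by omega⟩
  refine ⟨fun ω => Ψ (reblock M (2 * S + 1) (Φ₁ (evenPart ω)), oddPart ω),
    hΨm.comp (((measurable_reblock M (2 * S + 1)).comp (hΦ₁m.comp measurable_evenPart)).prodMk measurable_oddPart),
    law_compose_of_coders ρ β hΦ₁m hlaw₁ hΨm hlaw₂ (measurable_reblock M (2 * S + 1)) (reblock_blockField hM), ?_⟩
  intro e k hk
  obtain ⟨Ψf, hΨfm, hdep, htail⟩ := composite_locality ρ β hM hMN hΦ₁m hlaw₁ hloc₁ hloc₂ e k hk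
  refine ⟨Ψf, hΨfm, ?_, htail⟩
  exact DependsOn.mono (hst := fun p hp => inputBall_mono e (Nat.mul_le_mul_left k (le_max_left _ _)) hp) (hf := hdep)

/-- (rev 4: v2's composition with the TORUS FLOOR `volFloor β` threaded through U_UV, C3 and C2 — the certified Haar radius is
`max (c·2^{j⋆}) (volFloor β)`, which is all `fmtSet`-non-emptiness asks; v2 VERBATIM otherwise, incl. the `[SecondCountableTopology G]` binder in `hC3` discharged from `r` inside; rev 6: `hC3` guarded by `1 ≤ M`, used at `M = 2^{j⋆}`) **`E → C2 → C3 → T → U_UV → U_× → X → IRCal`** (real proof; `AfPincerUc.IRCal` is the body of `BalabanLadder.IR`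
verbatim).  Per group and representation: T makes the set of coded dyadic scales non-empty for `β ≥ β₂`, so the minimal one
`j⋆(β)` is coded (`Nat.sInf_mem`); with `j' := j⋆ − λ` (truncated), U_UV codes the fine field given the `2^{j'}`-blocks,
U_× codes the `2^{j'}`-blocks given the `2^{j⋆}`-blocks, C3 composes them into a conditional coder given the `2^{j⋆}`-blocks,
C2 composes that with T's coarse coder into a Haar coder at radius `c·2^{j⋆}` — so `fmtSet (HaarCodedSeq r.ρ K) β` is
non-empty for all large `β` — and the generic pincer (`fmtOnset_pinned` ⊕ `gapInUnits_of_fmtOnset`) concludes. -/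
theorem irCal_of_telescoped
    (hE : ∀ (G : Type) [Group G] [TopologicalSpace G] [IsTopologicalGroup G] [CompactSpace G]
      [MeasurableSpace G] [BorelSpace G] (r : LatticeRep G) (K : ℝ),
      FmtClustering r (HaarCodedSeq r.ρ K) (1 / 4 : ℝ) 4)
    (hC2 : ∀ (K₁ K₂ : ℝ) (b₁ b₂ : ℕ), ∃ (K : ℝ) (c : ℕ), 1 ≤ c ∧
      ∀ (G : Type) [Group G] [TopologicalSpace G] [IsTopologicalGroup G] [CompactSpace G]
        [MeasurableSpace G] [BorelSpace G] {N : ℕ} (ρ : G →* Matrix (Fin N) (Fin N) ℂ) (β : ℝ) (M fl : ℕ),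
        1 ≤ M → CoarseCodedSeq ρ K₁ β M b₁ → CondCodedSeqFrom fl ρ K₂ β M b₂ → HaarCodedSeq ρ K β (max (c * M) fl))
    (hC3 : ∀ (K₃ K₄ : ℝ) (b₃ b₄ : ℕ), ∃ (K₂ : ℝ) (b₂ : ℕ),
      ∀ (G : Type) [Group G] [TopologicalSpace G] [IsTopologicalGroup G] [CompactSpace G]
        [MeasurableSpace G] [BorelSpace G] [SecondCountableTopology G] {N : ℕ} (ρ : G →* Matrix (Fin N) (Fin N) ℂ) (β : ℝ) (M' M fl : ℕ),
        1 ≤ M' → 1 ≤ M → M' ∣ M → CondBlockCodedSeq ρ K₄ β M' M b₄ → CondCodedSeqFrom fl ρ K₃ β M' b₃ →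
          CondCodedSeqFrom fl ρ K₂ β M b₂)
    (hT : ∀ (G : Type) [Group G] [TopologicalSpace G] [IsTopologicalGroup G] [CompactSpace G],
      IsCompactSimpleLieGroup G →
      letI : MeasurableSpace G := borel G; haveI : BorelSpace G := ⟨rfl⟩;
      ∀ (r : LatticeRep G), ∃ (K₁ : ℝ) (b₁ : ℕ) (β₂ : ℝ), ∀ β : ℝ, β₂ ≤ β →
        ∃ j : ℕ, CoarseCodedSeq r.ρ K₁ β (2 ^ j) b₁)
    (hUV : ∀ (G : Type) [Group G] [TopologicalSpace G] [IsTopologicalGroup G] [CompactSpace G],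
      IsCompactSimpleLieGroup G →
      letI : MeasurableSpace G := borel G; haveI : BorelSpace G := ⟨rfl⟩;
      ∀ (r : LatticeRep G) (K₁ : ℝ) (b₁ : ℕ), ∃ (lam : ℕ) (K₃ : ℝ) (b₃ : ℕ) (β₃ : ℝ), ∀ β : ℝ, β₃ ≤ β →
        ∀ j' : ℕ, (j' + lam ≤ jStar r.ρ K₁ b₁ β ∨ j' = 0) → CondCodedSeqFrom (volFloor β) r.ρ K₃ β (2 ^ j') b₃)
    (hX4 : ∀ (G : Type) [Group G] [TopologicalSpace G] [IsTopologicalGroup G] [CompactSpace G],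
      IsCompactSimpleLieGroup G →
      letI : MeasurableSpace G := borel G; haveI : BorelSpace G := ⟨rfl⟩;
      ∀ (r : LatticeRep G) (K₁ : ℝ) (b₁ lam : ℕ), ∃ (K₄ : ℝ) (b₄ : ℕ) (β₄ : ℝ), ∀ β : ℝ, β₄ ≤ β →
        {j : ℕ | CoarseCodedSeq r.ρ K₁ β (2 ^ j) b₁}.Nonempty →
        ∀ j' : ℕ, j' ≤ jStar r.ρ K₁ b₁ β → jStar r.ρ K₁ b₁ β ≤ j' + lam →
          CondBlockCodedSeq r.ρ K₄ β (2 ^ j') (2 ^ jStar r.ρ K₁ b₁ β) b₄)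
    (hX : ∀ (G : Type) [Group G] [TopologicalSpace G] [IsTopologicalGroup G] [CompactSpace G],
      IsCompactSimpleLieGroup G →
      letI : MeasurableSpace G := borel G; haveI : BorelSpace G := ⟨rfl⟩;
      ∀ (r : LatticeRep G) (K : ℝ) (v : 𝓢(EuclideanSpace ℝ (Fin 4), ℝ)),
        tsupport v ⊆ {y : EuclideanSpace ℝ (Fin 4) | 0 < y 0} →
        ∀ η : ℝ, 0 < η → ∃ T β₁ : ℝ, ∀ β : ℝ, β₁ ≤ β → ∀ s : ℝ, 0 < s →
          T ≤ s * (fmtOnset (HaarCodedSeq r.ρ K) β : ℝ) →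
            ∃ᶠ (L : ℕ) in atTop, |Q2 G r β L s (thetaTest 4 v) v| ≤ η) :
    Summit.QuantumFields.YangMills.Cruxes.IR.AfPincerUc.IRCal := by
  intro G _ _ _ _ hG
  letI : MeasurableSpace G := borel G
  haveI : BorelSpace G := ⟨rfl⟩
  intro r a ha _ hlb
  haveI : SecondCountableTopology G :=
    (r.continuous.isClosedEmbedding r.injective).isEmbedding.secondCountableTopology
  obtain ⟨K₁, b₁, β₂, hT'⟩ := hT G hG r
  obtain ⟨lam, K₃, b₃, β₃, hUV'⟩ := hUV G hG r K₁ b₁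
  obtain ⟨K₄, b₄, β₄, hX4'⟩ := hX4 G hG r K₁ b₁ lam
  obtain ⟨K₂, b₂, hcomp3⟩ := hC3 K₃ K₄ b₃ b₄
  obtain ⟨K, c, hc, hcomp2⟩ := hC2 K₁ K₂ b₁ b₂
  have hon : ∀ β : ℝ, max β₂ (max β₃ β₄) ≤ β → (fmtSet (HaarCodedSeq r.ρ K) β).Nonempty := by
    intro β hβ
    have hβ₂ : β₂ ≤ β := (le_max_left _ _).trans hβ
    have hβ₃ : β₃ ≤ β := ((le_max_left _ _).trans (le_max_right _ _)).trans hβ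
    have hβ₄ : β₄ ≤ β := ((le_max_right _ _).trans (le_max_right _ _)).trans hβ
    -- the set of coded dyadic scales is non-empty, so its infimum `j⋆` is coded
    have hne : {j : ℕ | CoarseCodedSeq r.ρ K₁ β (2 ^ j) b₁}.Nonempty := hT' β hβ₂
    set js : ℕ := jStar r.ρ K₁ b₁ β with hjs
    have hco : CoarseCodedSeq r.ρ K₁ β (2 ^ js) b₁ := by
      have h := Nat.sInf_mem hne
      simpa [hjs, jStar] using h
    -- the scale `λ` octaves below (truncated at 0)
    set j' : ℕ := js - lam with hj'
    have hsplit : j' + lam ≤ js ∨ j' = 0 := by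
      by_cases h : lam ≤ js
      · exact Or.inl (by rw [hj', Nat.sub_add_cancel h])
      · exact Or.inr (by rw [hj']; exact Nat.sub_eq_zero_of_le (Nat.le_of_not_le h))
    have hcd : CondCodedSeqFrom (volFloor β) r.ρ K₃ β (2 ^ j') b₃ := hUV' β hβ₃ j' hsplit
    have hle : j' ≤ js := Nat.sub_le _ _
    have hge : js ≤ j' + lam := by rw [hj']; exact le_tsub_add
    have hcb : CondBlockCodedSeq r.ρ K₄ β (2 ^ j') (2 ^ js) b₄ := hX4' β hβ₄ hne j' hle hge
    have hM' : 1 ≤ 2 ^ j' := Nat.one_le_two_pow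
    have hdvd : 2 ^ j' ∣ 2 ^ js := pow_dvd_pow 2 hle
    have hcond : CondCodedSeqFrom (volFloor β) r.ρ K₂ β (2 ^ js) b₂ :=
      hcomp3 G r.ρ β (2 ^ j') (2 ^ js) (volFloor β) hM' Nat.one_le_two_pow hdvd hcb hcd
    have hM : 1 ≤ 2 ^ js := Nat.one_le_two_pow
    have hcM : 1 ≤ c * 2 ^ js := by simpa using Nat.mul_le_mul hc hM
    exact ⟨max (c * 2 ^ js) (volFloor β), le_trans hcM (le_max_left _ _),
      hcomp2 G r.ρ β (2 ^ js) (volFloor β) hM hco hcond⟩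
  have hcl : FmtClustering r (HaarCodedSeq r.ρ K) (1 / 4 : ℝ) 4 := hE G r K
  obtain ⟨T, β₆, hpin⟩ := fmtOnset_pinned (HaarCodedSeq r.ρ K) r a ha hlb (hX G hG r K)
  exact gapInUnits_of_fmtOnset r a ha (by norm_num) hcl hon hpin


/-- **The route decl BY NAME, no free hypotheses: `BalabanLadder.IR`** — rev 4: E (`HaarCodingEngine.codedClusteringSeq`, p597902) is a
TREE THEOREM fed by name and C2 is `composeCoders_from` (PROVED here from the tree's per-torus lemmas, floor threaded); U_UV is DISCHARGED
by the registered stubs below S₁ and by S₂; T, U_×, X come from `stub_telescopedWall` (the telescoped line's own registered research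
stubs, bundled); rev 5: S₂ is the THEOREM `iterateCondCoders_holds`; rev 6: C3 is the THEOREM `composeCond_holds`.  `sorry` only inside
`stub_*` — FOUR of them (rev 6.1: (M-a∕c), (M-b), levels, the wall T ∧ U_× ∧ X; (R≥) is the tree theorem `largeFieldRarityOddTori_holds`),
every one YM content: none about small tori, none about plumbing. -/
theorem IR_of_mechanism : Summit.QuantumFields.YangMills.Theses.BalabanLadder.IR := by
  obtain ⟨hT, hX4, hX⟩ := stub_telescopedWall
  have h : Summit.QuantumFields.YangMills.Cruxes.IR.AfPincerUc.IRCal :=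
    irCal_of_telescoped (fun G _ _ _ _ _ _ r K A B => codedClusteringSeq r K A B) composeCoders_from composeCond_holds hT
      (deepSmallFieldCondCoder_of oneStepCondCoder_of_stubs iterateCondCoders_holds) hX4 hX
  delta Summit.QuantumFields.YangMills.Theses.BalabanLadder.IR
  delta Summit.QuantumFields.YangMills.Cruxes.IR.AfPincerUc.IRCal at h
  exact h

end Summit.QuantumFields.YangMills.Cruxes.IR.SmallFieldPolymerCoder

end
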